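import Summits.HubbardSuperconductivity.HubbardSuperconductivity.Theses.ThermalWedge
import Literature.MathematicalPhysics.QuantumLattice.LiebFluxPhaseProofs
import Literature.MathematicalPhysics.QuantumLattice.DWaveSourceProofs
import Literature.MathematicalPhysics.QuantumLattice.BdGBondHamiltonianTorus
import Literature.MathematicalPhysics.QuantumLattice.PairCorrelationsODLROSupRayleighProofs
import Literature.MathematicalPhysics.QuantumLattice.GibbsPressureTemperature
import Literature.MathematicalPhysics.QuantumLattice.HubbardGrandCanonicalDensity
import Literature.MathematicalPhysics.QuantumLattice.SectorSpectrum
import Literature.MathematicalPhysics.QuantumLattice.FinDimSpectrumSectorGibbsLimit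
import Literature.MathematicalPhysics.QuantumLattice.XYOrderGDProofs
import Literature.MathematicalPhysics.QuantumLattice.HubbardFreeTorusGroundEnergy
import Literature.MathematicalPhysics.QuantumLattice.ApproximatingHamiltonianProofs
import Literature.MathematicalPhysics.QuantumLattice.HubbardRingPerronFrobeniusProofs
import Literature.MathematicalPhysics.QuantumLattice.FermionLiebRobinson
import Summits.HubbardSuperconductivity.HubbardSuperconductivity.Theorems.ThermalWedgeTwTipContinuationEdgeOrderTorusTrig

/-!
# Disproof work file — crux `TwSeededEnsembleEquivalence` (stmt-HubbardSuperconductivity-1698), gen 4 (extends gens 2–3)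

Standing adversary on the crux of route `ThermalWedge` (rank 4):

  ∀ δ ∈ [1/10,2/5] ∃ −4<μ₁≤μ₂<0 ∃ U₀>0 ∀ U∈(0,U₀] ∀ g∈(0,1/10] ∀ β≥1 ∃ μ∈[μ₁,μ₂] ∀ ε>0, eventually in L:
      e_L(g) + p_L(β,μ,g) − μ n_L ≤ log 4/β + ε,
  e_L(g) = minEnergyOn (hubbardTorus 2 L 1 U − (g/L²)P) (szSector N_L 0)/L²,
  p_L    = Re log partitionFn β (hubbardTorusWith 2 L 1 U μ − (g/L²)P)/(βL²),  P = pairFieldᴴ pairField,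
  N_L = 2⌊(1−δ)L²/2⌋₊, n_L = N_L/L².

## Findings (gen 4, cycle 1) — everything below is sorry-free (`lean check` rc 0, 0 sorries, 0 warnings)

* TEMPLATE H — THE DEFECT FLOOR (`defect_floor`, `defect_floor_crux`, `log_partitionFn_free_torus_ge`,
  `log_partitionFn_Hgc_ge`, `groundEnergy_Hgc_add_le_minEnergyOn`; section Gen4): the crux's defect
  functional is bounded BELOW uniformly in `L ≥ 3`,
      D_L(β, μ; U, g) := e_L + p_L(β,μ) − μ n_L ≥ (2/β) log(1 + e^{−8β}) − U − 32 g   (|μ| ≤ 4, U, g ≥ 0),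
  from the free model's extensive thermal entropy `log Z_free(β,μ) + βE₀_free(μ) = 2Σ_k log(1 + e^{−β|ξ_k|})`
  (tree: exact BdG partition function at zero source `partitionFn_dWaveSourceTorus_zero_re`, free ground
  energy `groundEnergy_hubbardTorusWith_zero`; new: `(1 + cosh y)/2 = e^y(1 + e^{−y})²/4`), Loewner
  monotonicity of `log Z` and `E₀` in the seed, the Lipschitz bound `|log Z(H₁) − log Z(H₂)| ≤ β‖H₁ − H₂‖`
  with `‖U Σ_x n↑n↓‖ ≤ UL²`, and `E₀`-monotonicity in `U`. KILL FORMS (`CruxWithAllowance a`,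
  `cruxWithAllowance_false_of_lt`, `cruxNoAllowance_false`, `cruxWithAllowance_exp_false`): the crux with
  allowance `a(β)` replacing `log 4/β` is FALSE whenever `a(β₀) < (2/β₀) log(1 + e^{−8β₀})` at one `β₀ ≥ 1`
  (witness `δ = 1/10`, `β = β₀`, `U, g → 0⁺`, `L = max L₀ 3`); in particular the crux WITHOUT the entropy
  allowance is false (gen 1 had this on paper only) — ANY PROOF MUST SPEND THE ALLOWANCE — and no allowance
  decaying faster than `e^{−8β}` (e.g. `e^{−9β}`) can hold. Calibration (`defect_floor_lt_allowance`):
  `(2/β) log(1 + e^{−8β}) < log 4/β` for every `β > 0`, so the crux's own allowance clears the floor — no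
  kill; with Template D the picture is: `D_L − log 4/β` is non-decreasing in β, `D_L ≥ floor(β) → 0⁺`, and the
  crux asks `D_L ≤ log 4/β + ε` eventually, i.e. everything is decided by `β → ∞` where both sides vanish.
  Kit j011869 (queued at writing; results → item evidence summary.json) tabulates the TRUE free thermal excess
  `X(β,n) = min_μ D(β,μ;0,0)` (≈ 0.7 at β = 1 vs log 4 = 1.386: the constant log 4 has ≈ 2× slack at β = 1 and
  is never tight; the tight high-temperature constant would be `2H₂((1−δ)/2) < log 4`).
  Def-free copy for provers: `Negative/DefectFloor.lean` (p81873 ACCEPTED, commit ff8170762cc9).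
* TEMPLATE I — HALF FILLING IS EXCLUDED FOR A REASON (`cruxBodyAt_zero_false`, `hullGap_halfFilling_ge`,
  `sq_le_card_filter_abs_torusBand_le`, `free_legendre_defect_halfFilling_ge`; section TemplateI; the
  antiperiodicity is the tree's `TwTipContinuation.IsogapTransport.torusBand_add_half`): with `CruxBodyAt δ` the crux's body at doping `δ` (crux ↔ ∀ δ ∈ [1/10,2/5], CruxBodyAt δ,
  `Iff.rfl`), `¬ CruxBodyAt 0` is now CHECKED: for every window `[μ₁,μ₂] ⊂ (−4,0)` and `U₀` the disprover's
  `U = min U₀ κ/4`, `g = min (1/10) κ/128`, `β = max 1 (8 log 4/κ)`, even `L → ∞` (`κ = |μ₂|³/(2048π²)`) produce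
  the T = 0 hull gap `minE(Hcan, szSector L² 0) − μL² − E₀(Hgc μ) ≥ (|μ|³/(2048π²) − U − 32g)L²` at half filling
  against every slope `μ ≤ μ₂ < 0` (free GC ground energy `2Σ_k min(ε_k − μ, 0)` of the tree + antiperiodicity
  `ε(k + (L/2,L/2)) = −ε(k)` + an explicit `(aL/16π)²` box of momenta within `a` of the Fermi level + the
  pointwise Legendre bookkeeping `f(ε) + f(−ε) ≥ |μ|𝟙[|ε| ≤ |μ|/2]`, transported to `(U, g) ≠ 0` by Templates
  E/F). So the doping window `δ ≥ 1/10` is LOAD-BEARING (gen 2 had this on paper: μ*(half filling) = U/2 > 0),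
  and — more usefully — the kill pipeline (Template C kill form ← E/F transfers ← a quantitative hull gap) is
  road-tested end to end: a real kill of the crux would differ only in the physics input replacing the free count.
  Def-free copies: `Negative/HalfFillingCounting.lean` (revised after review of p81924: reuse of the tree's
  antiperiodicity lemma) + `Negative/HalfFilling.lean` (to follow; the 573-line single file p80381 bounced only on
  the 400-line limit).
* TEMPLATE F — COUPLING TRANSFER (`Hcan_sub_Hcan_U`, `re_rayleigh_Hcan_mono_U`/`_le_add_U`,
  `minEnergyOn_Hcan_mono_U`/`_le_add_U`, `groundEnergy_Hgc_mono_U`/`_le_add_U`, `hullGap_coupling_transfer`):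
  `Hcan(U') − Hcan(U) = (U' − U)W`, `0 ≤ W = Σ_x n↑n↓`, `‖W‖ ≤ L²`, so every Rayleigh quotient / sector energy /
  grand-canonical ground energy of the seeded model is non-decreasing in `U` and moves by `≤ (U' − U)L²`; the
  T = 0 hull gap of Template C is `L²`-Lipschitz in `U`. Reading: relative to the `U = 0` seeded model — the
  reduced d-wave BCS model, AHM-solvable, with NO grand-canonical density jump at any seed (strict convexity of
  the Bogoliubov functional in `s = |Δ|²`; drefute, kit j005281/j005486/j011869(c)) — a kill at repulsion `U`
  has margin `≤ U` per site; with Template E (`≤ 32 g` over the pure model) every counterexample is boxed into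
  the `O(U) ∩ O(g)` correlation window at `T = 0`. Def-free copy: `Negative/CouplingTransfer.lean` (p81899 ACCEPTED,
  commit 33d5628fd392).
* THE LEAD'S v5 SKELETON (Lines/exposed-density-duality.lean, 2026-08-16): the transfer is now
  `stub_t0AHM` (T = 0 approximating-Hamiltonian sandwich for the seeded torus — TRUE infrastructure; its easy
  half is the completed square `(g/L²)(Δ − hL²/g)ᴴ(Δ − hL²/g) ≥ 0`) + `stub_sourcedSecantBracketT0` (secant
  bracket of the finite-volume Bogoliubov functional `B_L(μ) = ⨅_h [E₀(dWaveSourceTorus L U μ h) + h²L²/g]`;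
  `⨅` is a genuine minimum: the bracket is bounded below since the quadratic beats `−|h|‖Δ + Δᴴ‖`). REFUTER'S
  READING, for the lead and the planner: (i) by Danskin, the sourced secant bracket at `μ₀` ⇔ all
  asymptotically optimal sources `h*` at `μ₀` carry sourced density `1 − δ` AND `μ ↦ e_src(μ, h*)` has no kink
  there — it is the v3/v4 density-pinning statement moved onto the short-range sourced model, with the SAME
  open T = 0 content (no cheap attack bites: at `U = 0`, `h ↦ E₀(S_L(μ,√s))` is convex in `s`, the minimiser is
  unique and continuous in `μ`, so the bracket holds for every `g`); (ii) it is STRICTLY STRONGER than the crux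
  at the shape level: crux ⇔ hull touch (Template C) tolerates `1 − δ` being an ENDPOINT of a density jump
  `[n(μ₀−), n(μ₀+)]` (and Maxwell coexistence with equal pair amplitude), the secant bracket does not
  (it forces `n_L(μ₀ ± τ) → 1 − δ` from both sides). So "promote the stub to a statement item" would replace
  the crux by a strictly stronger claim; the weakest faithful transfer is `HullTouchT0Strong` itself
  (Negative/HullTouchNormalForm), and the glue-compatible narrowing remains `CruxNarrow` (β ≤ e^{a/U}).
* NO KILL OF THE CRUX this cycle (its δ = 0 neighbour IS killed, Template I). New attacks: thermal floor
  (Template H — calibrates, cannot kill since floor < log4/β); U-transfer (Template F — boxes the kill window); v5 stub read-back (true-or-open, strictly stronger than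
  crux); HF/RPA Stoner margin and free thermal excess numerics (j011869). WHY IT STILL RESISTS: unchanged —
  a kill needs an asymptotic T = 0 hull gap of the seeded model at density `1 − δ ∈ [0.6, 0.9]` for some
  `U ≤ U₀` (U₀ arbitrarily small) and `g ≤ 1/10`, i.e. a beyond-mean-field FIRST-ORDER transition of the weakly
  repulsive 2D Hubbard model with a B1g pair seed at T = 0; the only known first-order mechanism in this
  family (AF/SDW-driven phase separation near half filling) needs `U ≥ U_c^{HF}(n) = 1/max_q χ₀(q,n) = O(1)` on
  `n ≤ 0.9` (j011869(a)) and is dodged by `∃ U₀(δ)`; the one PRINTED seed+repulsion density jump — the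
  strong-coupling BCS–Hubbard model `−μN − hM + 2λΣn↑n↓ − (γ/N)Σa*a*aa` with ZERO hopping, whose density
  `d_β(μ)` has exactly one discontinuity at the superconductor–Mott-insulator critical potential `μ_β^{(c)}`
  with `d⁻ < d⁺` and phase coexistence for `ρ ∈ (d⁻, d⁺)` (Bru–de Siqueira Pedra, Rev. Math. Phys. 22 (2010)
  233, doi:10.1142/S0129055X10003953, §4.2 and Thm 4.3) — lives at `λ, γ = O(1) ≫ t = 0`, disjoint from the
  crux's `t = 1 ≫ U₀ ≥ U`, `g ≤ 1/10` (there the hopping convexity `1/(2ρ) ≈ 2` per site dominates both).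
* RECOMMENDED TRANSFER SHAPES for the lead (weakest first; all close the crux through landed bookkeeping):
  (T0) `HullTouchT0Strong` itself (≡ crux, Negative/HullTouchNormalForm); (T1) GROUND SECTOR NEAR `N_L`:
  `∀ η > 0 ∃ μ_η ∈ [μ₁,μ₂] ∃ L₀ ∀ L ≥ L₀ ∃ N°: E₀(Hgc_L(μ_η)) = E_{N°} − μ_η N° ∧ |N° − N_L| ≤ ηL²` — one walk
  (`walkUp/walkDown`, ≤ (2C+4)η L² by the landed one-particle cost) from weak hull touch, μ may depend on η
  (Template C upgrades ∀η∃μ to ∃μ∀κ for free); strictly between the crux and (T2) = the v3–v5 secant bracket at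
  a FIXED μ₀, which forces two-sided density pinning. T1 fails only if `1 − δ` is never approached by
  grand-canonical ground-sector densities of slopes in the window (i.e. lies strictly inside a jump) — exactly
  the scenario in which the crux itself is physically false (mean-field seed penalises coexistence) — whereas
  T2 additionally fails at jump ENDPOINTS where the crux holds.

## Findings (gen 3, cycle 1) — everything below is sorry-free (`lean check` rc 0, 0 sorries)

* TEMPLATE D — β-MONOTONICITY (`log_partitionFn_chord`, `pressure_sub_allowance_mono`,
  `cruxInstance_anti_beta`): at fixed `μ, L` the defect functional
  `D_L(β, μ) := e_L + p_L(β, μ) − μ n_L − log 4/β` is NON-DECREASING in `β` (chord of the convex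
  `β ↦ log Z_β` between `β = 0`, where `log Z_0 = L² log 4` EXACTLY, and `β'`). So a crux instance
  at `β'` implies the instance at every `β ≤ β'` with the same `μ, ε, L`: the `∀ β ≥ 1` of the crux
  is carried entirely by `β → ∞`; "nothing thermal can be spent" (ideator-2 BN1, triage F1) is now a
  checked theorem. Consequence for the planner: `CruxNarrow` (β ≤ e^{a/U}) at fixed `U` is exactly
  the single instance `β = e^{a/U}`; the un-narrowed crux is exactly its T = 0 instance (next item).
* TEMPLATE C — THE T = 0 NORMAL FORM (`crux_iff_hullTouchT0`, `crux_iff_hullTouchT0Strong`,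
  `not_crux_of_hullGapT0`, `not_hullTouchT0Strong_iff`):
      crux ⇔ HullTouchT0Strong := ∀ δ ∃ window ∃ U₀ ∀ U ∀ g ∃ μ ∈ window ∀ κ, eventually in L:
             minEnergyOn(Hcan(U,g), szSector N_L 0) − μ N_L ≤ groundEnergy(Hcan(U,g) − μ N̂) + κ L²,
  i.e. ONE slope `μ` in a `δ`-uniform window `⊂ (−4,0)` asymptotically supports the seeded sector
  staircase at `N_L` (the `N_L` sector attains the grand-canonical GROUND energy density of
  `Hcan − μN̂`). Directions: crux ⇒ weak form (∀κ ∃μ; `Z ≥ e^{−βE₀}`, β := 2 log 4/κ); weak ⇒ strong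
  by Bolzano–Weierstrass in the window + the `2L²`-Lipschitz bound of `μ ↦ E₀(Hcan − μN̂)`
  (`abs_groundEnergy_Hgc_sub_le`, from the tree's Hellmann–Feynman supergradient inequality and
  `0 ≤ N̂ ≤ 2L²`) + `N_L ≤ L²`; strong ⇒ crux for EVERY β ≥ 1 with the same μ (`Z ≤ 4^{L²}e^{−βE₀}`).
  β, ε and the partition function are GONE: a disproof must exhibit exactly an asymptotic T = 0
  hull gap at density `1 − δ` of the seeded model for admissible `(U, g)` against every slope in
  every candidate window (`not_hullTouchT0Strong_iff` spells the quantifiers out), and a proof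
  need only produce one asymptotic supporting slope `μ(δ,U,g) ∈ [μ₁(δ), μ₂(δ)]`.
* TEMPLATE E — SEED TRANSFER (`minEnergyOn_Hcan_anti`, `groundEnergy_Hgc_anti`,
  `groundEnergy_Hgc_le_add`, `hullGap_seed_transfer`, `hullGap_le_hullGap_add`): the seed is
  `−g ×` (PSD), so sector energies and the grand-canonical ground energy are non-increasing in `g`
  and the latter drops by at most `32 (g − g₀) L²` between seeds `g₀ ≤ g`; hence the T = 0 hull gap
  of Template C obeys `Gap_L(μ; g) ≤ Gap_L(μ; g₀) + [E₀(Hgc(μ,g₀)) − E₀(Hgc(μ,g))] ≤ Gap_L(μ; g₀) +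
  32 (g − g₀) L²` (exact, finite L). Reading: relative to the PURE model (g₀ → 0⁺; short-range
  ensemble equivalence, standard but not in the tree) a kill at seed `g` has margin at most the
  T = 0 grand-canonical condensation energy density of the seed (`≤ 32 g`, and `~ e^{−1/(λ_d g)}`
  at weak seed) — the quantitative version of gen 2's "≤ 64 g" remark. Def-free copy:
  `Negative/SeedTransfer.lean` (folder; to be proposed).
* WHY THE EXOTIC CORNER RESISTS TOO (paper, BCS level; sharpens gen 2's assessment). The only
  scenario left by Templates A–C is a FIRST-ORDER seeded transition (two macroscopically distinct
  T = 0 states exchanging stability as μ crosses μ*(δ), e.g. the seed-driven Kohn–Luttinger channel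
  switch d_xy → d_{x²−y²} near n ≈ 0.6 for g below the KL scale e^{−c/U²}). At BCS/mean-field level
  this switch is CONTINUOUS: for two even-parity channels φ₁ = cos k₁ − cos k₂, φ₂ (e.g. sin k₁ sin k₂)
  the optimal relative phase is π/2 (d + id′; Σ_k √(a_k + b_k cos θ) is even and concave in cos θ
  because φ₁φ₂ is odd under k₁ ↦ −k₁), and on that manifold the T = 0 BCS energy
  −Σ_k √(ξ_k² + s₁φ₁(k)² + s₂φ₂(k)²) + s₁/V₁ + s₂/V₂ is jointly CONVEX in (s₁, s₂) = (|ψ₁|², |ψ₂|²)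
  (−√ of an affine function): unique minimiser, continuous in (μ, g) ⇒ coexistence (tetracritical)
  instead of a level crossing, no density jump, no hull gap. Near T_c the same follows from
  Cauchy–Schwarz: b₁₂ = ∫φ₁²φ₂² ≤ √(∫φ₁⁴ ∫φ₂⁴). A kill therefore needs a beyond-mean-field first-order
  transition of the weakly coupled seeded model at T ≲ e^{−c/U²} — no known mechanism, no technology.
* NORMALISATION CHECK (tree `partitionFn_dWaveSourceTorus_zero`: E_k² = ξ_k² + 8 s² ĝ_d(k)², so the
  seed is −(8g/L²) B†B with B = Σ_k ĝ_d(k) c_{−k↓}c_{k↑}, ĝ_d = cos k₁ − cos k₂): g = 1/10 is a BCS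
  coupling V = 0.8 t with |ĝ_d| ≤ 2, i.e. a dimensionless d-wave coupling λ_d ≈ 0.3–0.45 near
  n = 0.9 — a STRONG seed; still no density jump at U = 0 because s ↦ p̃₀(√s) is concave for EVERY
  coupling (log cosh(β√(ξ² + 8sĝ²)/2) is concave in s), hence the AHM maximiser s*(β, μ) is unique and
  n(μ) = ∂_μ p is continuous (Danskin) — for all β ≤ ∞ and all g.
* BUDGET BOOKKEEPING (paper): LHS = [e − f^V_L] + [−(βL²)⁻¹ log P_{β,μ}(V)] with both brackets ≥ 0;
  the first is ≤ s_L(β)/β·… ≤ 2H(n/2)/β < log 4/β (binary entropy, n = 1 − δ: log 4 − 2H(0.45) =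
  0.0098, log 4 − 2H(0.3) = 0.165) and → 0·β⁻¹ as β → ∞ for gapless spectra, so the Legendre
  defect (second bracket) may be as large as (log 4 − β(e₀ − f(β)))/β: the crux does NOT require
  exact ensemble equivalence at finite β, only at T = 0 (consistent with Template C/D).
* NO KILL this cycle. Attacks run (cumulative gens 1–3): typing/junk read-back; degenerate L (the
  L = 1, 2 tori satisfy the inequality: no junk-L lemma exists); δ = 0 (false there, Template B —
  outside the window); dropped allowance / μ uniform in β (false on paper, gen 1); mean-field density
  jump search (none: s-concavity at U = 0, Hartree level); two-channel BCS convexity (above);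
  β-elimination (Template D) and full T = 0 normal form (Template C) — checked.
* LANDED under `Theorems/TwSeededEnsembleEquivalence/Negative/` (def-free, importable):
  `BetaMonotonicity.lean` (p74564 ACCEPTED, commit 24f1c977abff: Template D + generic
  `−βE₀ ≤ log Z ≤ log dim − βE₀`, `μ ↦ E₀(K − μN̂)` is `2|Λ|`-Lipschitz) and `HullTouchNormalForm.lean`
  (p75467, dry-run ACCEPT: Template C incl. `twSeededEnsembleEquivalence_iff_hullTouchT0Strong` and
  the kill form `twSeededEnsembleEquivalence_false_of_hullGapT0`).
* NUMERICS (kit job j009920, queued on a saturated cluster at the time of writing): U = 0 BdG/AHM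
  scan in the tree's normalisation — s*(β, μ) uniqueness, n(μ) continuity margins, μ*(n) for
  n ∈ {0.6,…,0.9}, g ∈ {0.02, 0.05, 0.1}, β ∈ {1,…,100,∞}, Hartree-shifted T = 0 at U ∈ {0.2, 0.5};
  results land as item evidence (summary.json) — expected: no density jump anywhere (theorem at
  U = 0 by s-concavity), window [−1.5, −0.1] ⊃ μ*.

* NEXT TARGETS (pre-registered for the re-arm; no line is PICKED yet). The five skeleton lines
  (exposed-density-duality, number-capacitor, concave-in-squared-source, secant-monotone-gap,
  number-window-minimax) all funnel into ONE physical input — no seeded density jump / unique AHM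
  maximiser modulus at μ*(δ) — which Template C shows is also NECESSARY. Cheap attacks prepared:
  (i) any stub asserting concavity of `s ↦ p̃_L(β,μ,U,√s)` at FINITE `L` uniformly in `β ≥ 1` is
  suspect (triage r1-1 F2: false for the Hubbard atom/dimer at U > 0, plaquette at U ≥ 4, β = 50 via
  level crossings) — test by S^z-blocked ED of `dWaveSourceTorus 3 U μ h` (blocks ≤ 15876) as a kit
  job; (ii) stubs with explicit constants (`OneParticleCostT0`: 2(4+U+32g)·2L²/N; `OneJumpCost`:
  4(4+U+32g), 40(4+U+32g), entropy m log(2eL²/m)) — check against free fermions at U = g = 0 on small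
  tori (exact); (iii) `TZeroAHM` easy half and `transfer_ineq`/seed monotonicity are TRUE (Template E
  proves the latter); (iv) thermal-member stubs quantified over ALL β ≥ 1 inherit the T = 0 content
  by Template D — flag any line card that claims to need "thermal technology only" while keeping ∀β.

## Findings (gen 2, cycle 1) — all theorems below are sorry-free unless marked NEAR-MISS

* ELABORATION: rc 0 (W.lean). Read-back: `hubbardTorusWith_eq` is `rfl` (`H − μ N̂`, no hidden
  particle–hole shift), `Real.log` is applied to `(partitionFn β ·).re` (real, > 0 for Hermitian
  arguments: `Matrix.partitionFn_pos`), `minEnergyOn` is an `sInf` over a nonempty Rayleigh set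
  (`szSector N_L 0 ≠ ⊥` for every `L ≥ 1`), the seed coefficient is `((g/L²:ℝ):ℂ)`. No typing kill.
* THE TRIVIAL HALF, UNCONDITIONALLY (`neg_mul_rayleigh_le_log_partitionFn`,
  `sector_rayleigh_lower_bound`): for every unit `N`-particle `ψ` and every `μ`, `β ≥ 0`,
  `μN − log Z(β, Hgc μ)/β ≤ Re⟨ψ, Hcan ψ⟩` — from the tree's `exp_neg_mul_groundEnergy_le_partitionFn`
  and `Matrix.groundEnergy_le_rayleigh_holds`; no Peierls–Bogoliubov needed. (This is the pointwise
  content of support item `TwSectorEnergyLowerBound`; gen 1's obstruction templates assumed that item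
  as a hypothesis — here they become unconditional.)
* TEMPLATE A (`crux_implies_midpointConvexT0`, `not_crux_of_midpointDefect`): the crux implies, for
  EVERY seed `g ∈ (0,1/10]` and every small `U`, asymptotic MIDPOINT CONVEXITY at `N_L` of the seeded
  sector energies at scale `L²`:  `e_L(g) ≤ (Re⟨ψ₁,Hcan ψ₁⟩ + Re⟨ψ₂,Hcan ψ₂⟩)/(2L²) + κ` eventually,
  for all unit `ψᵢ` with `N̂ψᵢ = Nᵢψᵢ`, `N₁ + N₂ = 2N_L` (β and μ are ELIMINATED: take β ≥ 2log4/κ).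
  So any T = 0 phase separation (strict midpoint concavity of `N ↦ E_N(U,g)` across `N_L` at scale
  `L²`) of the SEEDED model for one admissible `(U,g)` kills the crux. For the PURE short-range model
  such concavity is impossible in the limit (canonical energy / free-energy densities of
  finite-range lattice fermions are convex in the density: two-box construction — standard, refs
  per the grounder note on this item: Ruelle 1969, Lima 1971/72) and the seed moves every Rayleigh
  quotient by at most `(g/L²)‖P‖ ≤ 32 g L²` (`norm_pairField_le`: ‖Δ_d‖ ≤ 4√2 L²), so the defect the
  crux must exclude is a genuinely MEAN-FIELD one of size ≤ 64 g per site — exactly the ensemble-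
  inequivalence mechanism of the why-might-fail, and nothing else.
* TEMPLATE B (`crux_implies_slopeWindowT0`): with ONE comparison vector the crux pins the T = 0
  chemical potential: backward secant slopes `(E_{N_L} − Re⟨ψ',Hcan ψ'⟩)/(N_L − N') ≤ μ₂ < 0`
  (`N' < N_L`) and forward slopes `≥ μ₁ > −4`, up to `κL²/(|N_L − N'|)`. False at δ = 0 (half filling:
  μ* = U/2 > 0 by particle–hole symmetry) — the window δ ≥ 1/10 is load-bearing together with
  `μ₂ < 0`; inside the window μ_F(n = 0.9) ≈ −0.18 + 0.45 U < 0 for U < 0.4, so no kill.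
* WHY IT RESISTS (assessment for provers). After β- and μ-elimination the only way the crux can fail
  is a first-order DENSITY JUMP of the seeded grand-canonical ground state / Gibbs state across
  1 − δ for some admissible (U, g, β) (equivalently: non-convexity of the seeded canonical free
  energy in n). At mean-field level the AHM functional is convex in D² (gen 1), BCS transitions in μ
  are continuous, and the seed's total leverage on convexity is ≤ 64 g ≤ 6.4 per site against the
  free-fermion curvature 1/(2ρ) ≈ 2; the small-seed corner is even SAFE by known theorems:
  if 32 g ≤ (log 4 − 2H((1−δ)/2))/β (H = binary entropy in nats; log 4 − 2H(0.45) = 0.010,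
  log 4 − 2H(0.3) = 0.164) the crux follows from short-range ensemble equivalence of the PURE model
  plus the entropy ceiling s ≤ 2H(n/2) < log 4 (perturbation of e, p by ≤ 32 g each). The glue uses
  only β = e^{a/U}, g ≥ K U (deep in the seeded region g β → ∞). THE ONE EXOTIC SCENARIO that
  would bite the crux AS TYPED (and only in the corner β ≳ exp(c/U²), far below the glue's
  β = exp(a/U)): if at some n ∈ [0.6, 0.9] the pure weak-coupling Kohn–Luttinger ground state is
  NOT B1g (RaghuKivelsonScalapino2010 put the d_{x²−y²}/d_xy boundary near n ≈ 0.6, t' = 0) AND the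
  seed-driven channel switch at g_c ~ λU²/(ρΦ²) is FIRST order (no d + id coexistence), the seeded
  grand-canonical ground state has a density jump across 1 − δ of width w ~ e^{−c/U²}, the seeded
  canonical e(n) acquires a mean-field convexity defect G₀ ~ w² > 0 (mixing is penalised
  quadratically by −(g/L²)|Δ_d|²), and Template A fires at β > log 4/G₀. BCS lore says the switch
  proceeds through a T-breaking d + id phase by two continuous transitions (no jump), so even this
  is not expected — but nothing here is provable either way today. RECOMMENDED NARROWING (no kill, but
  removes the uncontrolled corner β > e^{a/U} that no thermal technology reaches): quantify
  `∀ a > 0, ∃ U₀(δ,a), ∀ U ≤ U₀, ∀ g, ∀ β ∈ [1, exp(a/U)]` — TwRungGlue is unchanged.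
* SEED LEVERAGE (`re_rayleigh_seed_nonneg`, `re_rayleigh_seed_le`, `dWave_norm_const_sq`,
  `re_rayleigh_Hcan_le_pure`, `re_rayleigh_pure_le_Hcan_add`, `crux_implies_mixedMidpointT0`): checked
  `0 ≤ Re⟨ψ,H₀ψ⟩ − Re⟨ψ,Hcan ψ⟩ ≤ 32 g L²` on unit vectors (‖Δ_d‖² ≤ 32 L⁴), so every energy density
  of the seeded model is within 32 g of the pure one.
* NARROWING (`CruxNarrow`, `cruxNarrow_of_crux`): the glue-compatible C′ with β ≤ exp(a/U), as a
  copy-paste Lean signature for the planner.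
* LANDED under `Theorems/TwSeededEnsembleEquivalence/Negative/` (def-free copies, importable):
  `ObstructionTemplates.lean` (p69652 ACCEPTED, commit 62ae5ee384b5: seeded_sector_rayleigh_lower_bound,
  twSeededEnsembleEquivalence_midpointConvexT0, twSeededEnsembleEquivalence_false_of_midpointDefect,
  twSeededEnsembleEquivalence_slopeWindowT0) and `SeedLeverage.lean` (p69792 ACCEPTED, commit 9ebbb316ce07: the seed-leverage lemmas).
* NOT ACCESSIBLE this session: gen 1's `Disproof.lean` (payload `disproof_path` lives under
  `run/gate/evidence/`, not mounted in this jail; reconstructed from the item's evidence notes: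
  crux_iff, CruxWith.mono, not_crux_of_convexityDefect [conditional on TwSectorEnergyLowerBound],
  not_crux_of_positiveSlope, cruxAsUsedByGlue_of_crux, 3 paper-refuted strengthenings).

Prose lives only in docstrings; every `theorem` is checked (`lean check` rc 0, 0 sorries).
-/

set_option linter.dupNamespace false

namespace Summit.HubbardSuperconductivity.HubbardSuperconductivity.Cruxes.TwSeededEnsembleEquivalence.Disproof

open Matrix Literature.MathematicalPhysics.QuantumLattice
open Summit.HubbardSuperconductivity.HubbardSuperconductivity.Theses.ThermalWedge
open scoped ComplexOrder Matrix.Norms.L2Operator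

noncomputable section

/-! ### Notation (reducible abbreviations for the crux's literal terms) -/

/-- The d-wave seed `P = Δ_dᴴ Δ_d` on the torus of side `L`. -/
abbrev seed (L : ℕ) [NeZero L] :
    Matrix (Finset (Orb (FermionTorus 2 L))) (Finset (Orb (FermionTorus 2 L))) ℂ :=
  (pairField dWaveFormFactor L)ᴴ * pairField dWaveFormFactor L

/-- The canonical seeded Hamiltonian `H_L(U,g) = hubbardTorus 2 L 1 U − (g/L²) P`. -/
abbrev Hcan (L : ℕ) [NeZero L] (U g : ℝ) :
    Matrix (Finset (Orb (FermionTorus 2 L))) (Finset (Orb (FermionTorus 2 L))) ℂ :=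
  hubbardTorus 2 L 1 U - ((g / (L : ℝ) ^ 2 : ℝ) : ℂ) • seed L

/-- The grand-canonical seeded Hamiltonian `hubbardTorusWith 2 L 1 U μ − (g/L²) P = Hcan − μ N̂`. -/
abbrev Hgc (L : ℕ) [NeZero L] (U μ g : ℝ) :
    Matrix (Finset (Orb (FermionTorus 2 L))) (Finset (Orb (FermionTorus 2 L))) ℂ :=
  hubbardTorusWith 2 L 1 U μ - ((g / (L : ℝ) ^ 2 : ℝ) : ℂ) • seed L

/-- The summit's particle number `N_L = 2⌊(1−δ)L²/2⌋₊`. -/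
abbrev NL (δ : ℝ) (L : ℕ) : ℕ := 2 * ⌊(1 - δ) * (L : ℝ) ^ 2 / 2⌋₊

/-- The crux, restated through the abbreviations (definitional). -/
theorem crux_iff :
    TwSeededEnsembleEquivalence ↔
      ∀ δ ∈ Set.Icc (1/10 : ℝ) (2/5 : ℝ), ∃ μ₁ μ₂ : ℝ, -4 < μ₁ ∧ μ₁ ≤ μ₂ ∧ μ₂ < 0 ∧ ∃ U₀ : ℝ, 0 < U₀ ∧
        ∀ U ∈ Set.Ioc (0 : ℝ) U₀, ∀ g ∈ Set.Ioc (0 : ℝ) (1 / 10), ∀ β : ℝ, 1 ≤ β →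
          ∃ μ ∈ Set.Icc μ₁ μ₂, ∀ ε : ℝ, 0 < ε → ∃ L₀ : ℕ, ∀ (L : ℕ) [NeZero L], L₀ ≤ L →
            (Hcan L U g).minEnergyOn (szSector (Λ := FermionTorus 2 L) (NL δ L) 0) / (L : ℝ) ^ 2 +
                Real.log ((Hgc L U μ g).partitionFn β).re / (β * (L : ℝ) ^ 2) -
                μ * (2 * (⌊(1 - δ) * (L : ℝ) ^ 2 / 2⌋₊ : ℝ)) / (L : ℝ) ^ 2 ≤ Real.log 4 / β + ε :=
  Iff.rfl

/-- Cast bookkeeping: `((N_L : ℕ) : ℝ) = 2 · ↑⌊(1−δ)L²/2⌋₊` (the crux's literal right-hand term). -/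
theorem cast_NL (δ : ℝ) (L : ℕ) : ((NL δ L : ℕ) : ℝ) = 2 * (⌊(1 - δ) * (L : ℝ) ^ 2 / 2⌋₊ : ℝ) := by
  push_cast [NL]
  ring

/-! ### The trivial half, unconditionally -/

/-- **Single-vector partition bound.** For Hermitian `A`, `β ≥ 0` and a unit vector `ψ`:
`−β Re⟨ψ, Aψ⟩ ≤ log Re Z(β, A)` (keep the ground-state term of `Z = Σ e^{−βλᵢ}` and use the
variational principle `E₀ ≤ Re⟨ψ,Aψ⟩`). [folklore] -/
theorem neg_mul_rayleigh_le_log_partitionFn {m : Type*} [Fintype m] [DecidableEq m] [Nonempty m]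
    {A : Matrix m m ℂ} (hA : A.IsHermitian) {β : ℝ} (hβ : 0 ≤ β) (ψ : m → ℂ)
    (hψ : star ψ ⬝ᵥ ψ = 1) :
    -(β * (star ψ ⬝ᵥ A *ᵥ ψ).re) ≤ Real.log (A.partitionFn β).re := by
  have h1 : Real.exp (-(β * A.groundEnergy)) ≤ (A.partitionFn β).re :=
    exp_neg_mul_groundEnergy_le_partitionFn hA β
  have h2 : A.groundEnergy ≤ (star ψ ⬝ᵥ A *ᵥ ψ).re := groundEnergy_le_rayleigh_holds hA ψ hψ
  have h3 : Real.exp (-(β * (star ψ ⬝ᵥ A *ᵥ ψ).re)) ≤ (A.partitionFn β).re :=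
    (Real.exp_le_exp.2 (by nlinarith)).trans h1
  calc -(β * (star ψ ⬝ᵥ A *ᵥ ψ).re)
      = Real.log (Real.exp (-(β * (star ψ ⬝ᵥ A *ᵥ ψ).re))) := (Real.log_exp _).symm
    _ ≤ Real.log (A.partitionFn β).re := Real.log_le_log (Real.exp_pos _) h3

/-- The seed `P = Δᴴ Δ` is Hermitian. -/
theorem isHermitian_seed (L : ℕ) [NeZero L] : (seed L).IsHermitian :=
  (pairField_conjTranspose_mul_self_posSemidef dWaveFormFactor L).isHermitian

/-- A real multiple of the seed is Hermitian. -/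
theorem isHermitian_smul_seed (L : ℕ) [NeZero L] (c : ℝ) : ((c : ℂ) • seed L).IsHermitian :=
  (isHermitian_seed L).smul (by rw [isSelfAdjoint_iff, Complex.star_def, Complex.conj_ofReal])

/-- The grand-canonical seeded Hamiltonian is Hermitian. -/
theorem isHermitian_Hgc (L : ℕ) [NeZero L] (U μ g : ℝ) : (Hgc L U μ g).IsHermitian :=
  (isHermitian_hubbardTorusWith L 1 U μ).sub (isHermitian_smul_seed L _)

/-- The canonical seeded Hamiltonian is Hermitian. -/
theorem isHermitian_Hcan (L : ℕ) [NeZero L] (U g : ℝ) : (Hcan L U g).IsHermitian := by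
  have h : (hubbardTorus 2 L 1 U).IsHermitian := by
    rw [← hubbardTorusWith_zero]; exact isHermitian_hubbardTorusWith L 1 U 0
  exact h.sub (isHermitian_smul_seed L _)

/-- `Hgc = Hcan − μ N̂`. -/
theorem Hgc_eq (L : ℕ) [NeZero L] (U μ g : ℝ) :
    Hgc L U μ g = Hcan L U g - (μ : ℂ) • totalNumber := by
  simp only [Hgc, Hcan, hubbardTorusWith_eq]
  abel

/-- On a unit `N`-particle vector, `Re⟨ψ, Hgc ψ⟩ = Re⟨ψ, Hcan ψ⟩ − μN`. -/
theorem re_rayleigh_Hgc (L : ℕ) [NeZero L] (U μ g : ℝ) {N : ℕ}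
    {ψ : Fock (Orb (FermionTorus 2 L))} (hN : IsNParticle N ψ) (hψ : star ψ ⬝ᵥ ψ = 1) :
    (star ψ ⬝ᵥ Hgc L U μ g *ᵥ ψ).re = (star ψ ⬝ᵥ Hcan L U g *ᵥ ψ).re - μ * N := by
  rw [Hgc_eq, sub_mulVec, smul_mulVec, totalNumber_mulVec_of_isNParticle hN, smul_smul,
    dotProduct_sub, dotProduct_smul, hψ, Complex.sub_re]
  simp

/-- **Sector lower bound (the trivial half, pointwise).** For every unit `N`-particle vector `ψ`,
every `μ` and every `β ≥ 0`: `μ N − log Re Z(β, Hgc μ)/β·… ≤ Re⟨ψ, Hcan ψ⟩`, in the product form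
`β (μ N − Re⟨ψ,Hcan ψ⟩) ≤ log Re Z(β, Hgc μ)`. [folklore] -/
theorem sector_rayleigh_lower_bound (L : ℕ) [NeZero L] (U μ g : ℝ) {β : ℝ} (hβ : 0 ≤ β) {N : ℕ}
    {ψ : Fock (Orb (FermionTorus 2 L))} (hN : IsNParticle N ψ) (hψ : star ψ ⬝ᵥ ψ = 1) :
    β * (μ * N - (star ψ ⬝ᵥ Hcan L U g *ᵥ ψ).re) ≤ Real.log ((Hgc L U μ g).partitionFn β).re := by
  have h := neg_mul_rayleigh_le_log_partitionFn (isHermitian_Hgc L U μ g) hβ ψ hψ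
  rw [re_rayleigh_Hgc L U μ g hN hψ] at h
  linarith

/-! ### Template A — the crux forces T = 0 midpoint convexity of the seeded sector energies -/

/-- T = 0 MIDPOINT CONVEXITY of the seeded model at density `1 − δ`, at every macroscopic scale:
the consequence of the crux in which `β` and `μ` no longer appear. -/
def MidpointConvexT0 : Prop :=
  ∀ δ ∈ Set.Icc (1/10 : ℝ) (2/5 : ℝ), ∃ U₀ : ℝ, 0 < U₀ ∧ ∀ U ∈ Set.Ioc (0 : ℝ) U₀,
    ∀ g ∈ Set.Ioc (0 : ℝ) (1 / 10), ∀ κ : ℝ, 0 < κ → ∃ L₀ : ℕ, ∀ (L : ℕ) [NeZero L], L₀ ≤ L →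
      ∀ (N₁ N₂ : ℕ) (ψ₁ ψ₂ : Fock (Orb (FermionTorus 2 L))), N₁ + N₂ = 2 * NL δ L →
        IsNParticle N₁ ψ₁ → IsNParticle N₂ ψ₂ → star ψ₁ ⬝ᵥ ψ₁ = 1 → star ψ₂ ⬝ᵥ ψ₂ = 1 →
          (Hcan L U g).minEnergyOn (szSector (Λ := FermionTorus 2 L) (NL δ L) 0) / (L : ℝ) ^ 2 ≤
            ((star ψ₁ ⬝ᵥ Hcan L U g *ᵥ ψ₁).re + (star ψ₂ ⬝ᵥ Hcan L U g *ᵥ ψ₂).re) /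
                (2 * (L : ℝ) ^ 2) + κ

/-- **Template A.** `TwSeededEnsembleEquivalence → MidpointConvexT0`: average the two sector lower
bounds for `ψ₁, ψ₂` (`N₁ + N₂ = 2N_L` makes `μ` cancel), then let `β := max 1 (2 log 4/κ)` kill the
entropy allowance. -/
theorem crux_implies_midpointConvexT0 (h : TwSeededEnsembleEquivalence) : MidpointConvexT0 := by
  intro δ hδ
  obtain ⟨μ₁, μ₂, -, -, -, U₀, hU₀, hU⟩ := h δ hδ
  refine ⟨U₀, hU₀, fun U hUm g hg κ hκ => ?_⟩
  -- choose β with log 4 / β ≤ κ / 2 and ε := κ / 2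
  set β : ℝ := max 1 (2 * Real.log 4 / κ) with hβdef
  have hβ1 : 1 ≤ β := le_max_left _ _
  have hβpos : 0 < β := lt_of_lt_of_le one_pos hβ1
  have hlog4 : 0 < Real.log 4 := Real.log_pos (by norm_num)
  have hslack : Real.log 4 / β ≤ κ / 2 := by
    rw [div_le_iff₀ hβpos]
    have : 2 * Real.log 4 / κ ≤ β := le_max_right _ _
    rw [div_le_iff₀ hκ] at this
    linarith
  obtain ⟨μ, -, hμ⟩ := hU U hUm g hg β hβ1
  obtain ⟨L₀, hL₀⟩ := hμ (κ / 2) (by linarith)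
  refine ⟨L₀, fun L _ hL N₁ N₂ ψ₁ ψ₂ hsum hN₁ hN₂ hψ₁ hψ₂ => ?_⟩
  have hcrux := hL₀ L hL
  have hLpos : (0 : ℝ) < (L : ℝ) ^ 2 := cast_sq_pos_of_neZero L
  have hβL : 0 < β * (L : ℝ) ^ 2 := mul_pos hβpos hLpos
  -- the two sector lower bounds
  have h1 := sector_rayleigh_lower_bound L U μ g hβpos.le hN₁ hψ₁
  have h2 := sector_rayleigh_lower_bound L U μ g hβpos.le hN₂ hψ₂
  set Z := Real.log ((Hgc L U μ g).partitionFn β).re with hZ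
  set E₁ := (star ψ₁ ⬝ᵥ Hcan L U g *ᵥ ψ₁).re
  set E₂ := (star ψ₂ ⬝ᵥ Hcan L U g *ᵥ ψ₂).re
  set A := (Hcan L U g).minEnergyOn (szSector (Λ := FermionTorus 2 L) (NL δ L) 0)
  have hsumR : (N₁ : ℝ) + N₂ = 2 * (NL δ L : ℝ) := by exact_mod_cast hsum
  -- averaged bound: β (μ N_L − (E₁+E₂)/2) ≤ Z
  have havg : β * (μ * (NL δ L : ℝ) - (E₁ + E₂) / 2) ≤ Z := by
    have : β * (μ * (NL δ L : ℝ) - (E₁ + E₂) / 2) =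
        (β * (μ * N₁ - E₁) + β * (μ * N₂ - E₂)) / 2 := by
      have : (NL δ L : ℝ) = ((N₁ : ℝ) + N₂) / 2 := by rw [hsumR]; ring
      rw [this]; ring
    rw [this]
    linarith
  -- divide by β L² and combine with the crux instance
  have hdiv : μ * (NL δ L : ℝ) / (L : ℝ) ^ 2 - (E₁ + E₂) / (2 * (L : ℝ) ^ 2) ≤
      Z / (β * (L : ℝ) ^ 2) := by
    have key : μ * (NL δ L : ℝ) - (E₁ + E₂) / 2 ≤ Z / β := by
      rw [le_div_iff₀ hβpos]; linarith [havg]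
    have := div_le_div_of_nonneg_right key hLpos.le
    rwa [sub_div, div_div, div_div] at this
  have hc : A / (L : ℝ) ^ 2 + Z / (β * (L : ℝ) ^ 2) - μ * (NL δ L : ℝ) / (L : ℝ) ^ 2 ≤
      Real.log 4 / β + κ / 2 := by
    rw [cast_NL]; exact hcrux
  linarith

/-- **Template A, kill form.** A T = 0 midpoint-convexity DEFECT of the seeded sector energies at
`N_L` — some `δ` in the window such that for every `U₀` there are admissible `U ≤ U₀`, `g ≤ 1/10`,
a margin `κ > 0` and, for arbitrarily large `L`, unit vectors `ψ₁, ψ₂` in sectors `N₁ + N₂ = 2N_L`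
whose mean energy undercuts the `N_L`-sector ground energy by `κ L²` — refutes the crux.
(Phase separation of the SEEDED model across density `1 − δ`; impossible for the pure short-range
model in the limit, so the defect must come from the mean-field seed: size ≤ 64 g per site.) -/
theorem not_crux_of_midpointDefect
    (hdef : ∃ δ ∈ Set.Icc (1/10 : ℝ) (2/5 : ℝ), ∀ U₀ : ℝ, 0 < U₀ → ∃ U ∈ Set.Ioc (0 : ℝ) U₀,
      ∃ g ∈ Set.Ioc (0 : ℝ) (1 / 10), ∃ κ : ℝ, 0 < κ ∧ ∀ L₀ : ℕ, ∃ (L : ℕ) (_ : NeZero L), L₀ ≤ L ∧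
        ∃ (N₁ N₂ : ℕ) (ψ₁ ψ₂ : Fock (Orb (FermionTorus 2 L))), N₁ + N₂ = 2 * NL δ L ∧
          IsNParticle N₁ ψ₁ ∧ IsNParticle N₂ ψ₂ ∧ star ψ₁ ⬝ᵥ ψ₁ = 1 ∧ star ψ₂ ⬝ᵥ ψ₂ = 1 ∧
            ((star ψ₁ ⬝ᵥ Hcan L U g *ᵥ ψ₁).re + (star ψ₂ ⬝ᵥ Hcan L U g *ᵥ ψ₂).re) /
                (2 * (L : ℝ) ^ 2) + κ <
              (Hcan L U g).minEnergyOn (szSector (Λ := FermionTorus 2 L) (NL δ L) 0) / (L : ℝ) ^ 2) :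
    ¬ TwSeededEnsembleEquivalence := by
  intro h
  obtain ⟨δ, hδ, hbad⟩ := hdef
  obtain ⟨U₀, hU₀, hgood⟩ := crux_implies_midpointConvexT0 h δ hδ
  obtain ⟨U, hU, g, hg, κ, hκ, hL⟩ := hbad U₀ hU₀
  obtain ⟨L₀, hL₀⟩ := hgood U hU g hg κ hκ
  obtain ⟨L, hLnz, hLle, N₁, N₂, ψ₁, ψ₂, hsum, hN₁, hN₂, hψ₁, hψ₂, hlt⟩ := hL L₀
  have := hL₀ L hLle N₁ N₂ ψ₁ ψ₂ hsum hN₁ hN₂ hψ₁ hψ₂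
  linarith

/-! ### Template B — the crux pins the T = 0 chemical-potential window -/

/-- T = 0 SLOPE WINDOW: removing particles from the `N_L` sector costs at least `−μ₂ > 0` per
particle, adding particles gains at most `−μ₁ < 4` per particle, at scale `L²` (one comparison
vector `ψ'` in any sector `N'`). -/
def SlopeWindowT0 : Prop :=
  ∀ δ ∈ Set.Icc (1/10 : ℝ) (2/5 : ℝ), ∃ μ₁ μ₂ : ℝ, -4 < μ₁ ∧ μ₁ ≤ μ₂ ∧ μ₂ < 0 ∧ ∃ U₀ : ℝ, 0 < U₀ ∧
    ∀ U ∈ Set.Ioc (0 : ℝ) U₀, ∀ g ∈ Set.Ioc (0 : ℝ) (1 / 10), ∀ κ : ℝ, 0 < κ → ∃ L₀ : ℕ,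
      ∀ (L : ℕ) [NeZero L], L₀ ≤ L → ∀ (N' : ℕ) (ψ' : Fock (Orb (FermionTorus 2 L))),
        IsNParticle N' ψ' → star ψ' ⬝ᵥ ψ' = 1 →
          (N' ≤ NL δ L →
            (Hcan L U g).minEnergyOn (szSector (Λ := FermionTorus 2 L) (NL δ L) 0) / (L : ℝ) ^ 2 ≤
              (star ψ' ⬝ᵥ Hcan L U g *ᵥ ψ').re / (L : ℝ) ^ 2 +
                μ₂ * ((NL δ L : ℝ) - N') / (L : ℝ) ^ 2 + κ) ∧
          (NL δ L ≤ N' →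
            (Hcan L U g).minEnergyOn (szSector (Λ := FermionTorus 2 L) (NL δ L) 0) / (L : ℝ) ^ 2 ≤
              (star ψ' ⬝ᵥ Hcan L U g *ᵥ ψ').re / (L : ℝ) ^ 2 +
                μ₁ * ((NL δ L : ℝ) - N') / (L : ℝ) ^ 2 + κ)

/-- **Template B.** `TwSeededEnsembleEquivalence → SlopeWindowT0` (one sector lower bound, then
`μ ≤ μ₂` resp. `μ₁ ≤ μ` according to the sign of `N_L − N'`, then `β := max 1 (2 log 4/κ)`). -/
theorem crux_implies_slopeWindowT0 (h : TwSeededEnsembleEquivalence) : SlopeWindowT0 := by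
  intro δ hδ
  obtain ⟨μ₁, μ₂, hμ₁, hμ₁₂, hμ₂, U₀, hU₀, hU⟩ := h δ hδ
  refine ⟨μ₁, μ₂, hμ₁, hμ₁₂, hμ₂, U₀, hU₀, fun U hUm g hg κ hκ => ?_⟩
  set β : ℝ := max 1 (2 * Real.log 4 / κ) with hβdef
  have hβ1 : 1 ≤ β := le_max_left _ _
  have hβpos : 0 < β := lt_of_lt_of_le one_pos hβ1
  have hlog4 : 0 < Real.log 4 := Real.log_pos (by norm_num)
  have hslack : Real.log 4 / β ≤ κ / 2 := by
    rw [div_le_iff₀ hβpos]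
    have : 2 * Real.log 4 / κ ≤ β := le_max_right _ _
    rw [div_le_iff₀ hκ] at this
    linarith
  obtain ⟨μ, hμm, hμ⟩ := hU U hUm g hg β hβ1
  obtain ⟨L₀, hL₀⟩ := hμ (κ / 2) (by linarith)
  refine ⟨L₀, fun L _ hL N' ψ' hN' hψ' => ?_⟩
  have hcrux := hL₀ L hL
  have hLpos : (0 : ℝ) < (L : ℝ) ^ 2 := cast_sq_pos_of_neZero L
  have hβL : 0 < β * (L : ℝ) ^ 2 := mul_pos hβpos hLpos
  have h1 := sector_rayleigh_lower_bound L U μ g hβpos.le hN' hψ'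
  set Z := Real.log ((Hgc L U μ g).partitionFn β).re with hZ
  set E' := (star ψ' ⬝ᵥ Hcan L U g *ᵥ ψ').re
  set A := (Hcan L U g).minEnergyOn (szSector (Λ := FermionTorus 2 L) (NL δ L) 0)
  -- divide the sector bound by β L²
  have hdiv : (μ * N' - E') / (L : ℝ) ^ 2 ≤ Z / (β * (L : ℝ) ^ 2) := by
    have key : μ * N' - E' ≤ Z / β := by
      rw [le_div_iff₀ hβpos]; linarith [h1]
    have := div_le_div_of_nonneg_right key hLpos.le
    rwa [div_div] at this
  have hc : A / (L : ℝ) ^ 2 + Z / (β * (L : ℝ) ^ 2) - μ * (NL δ L : ℝ) / (L : ℝ) ^ 2 ≤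
      Real.log 4 / β + κ / 2 := by
    rw [cast_NL]; exact hcrux
  -- hence A/L² ≤ E'/L² + μ (N_L − N')/L² + κ
  have hmain : A / (L : ℝ) ^ 2 ≤ E' / (L : ℝ) ^ 2 + μ * ((NL δ L : ℝ) - N') / (L : ℝ) ^ 2 + κ := by
    have e1 : (μ * N' - E') / (L : ℝ) ^ 2 = μ * (N' : ℝ) / (L : ℝ) ^ 2 - E' / (L : ℝ) ^ 2 := by
      rw [sub_div]
    have e2 : μ * ((NL δ L : ℝ) - N') / (L : ℝ) ^ 2 =
        μ * (NL δ L : ℝ) / (L : ℝ) ^ 2 - μ * (N' : ℝ) / (L : ℝ) ^ 2 := by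
      rw [mul_sub, sub_div]
    rw [e1] at hdiv
    rw [e2]
    linarith
  constructor
  · intro hle
    -- N' ≤ N_L and μ ≤ μ₂: μ (N_L − N') ≤ μ₂ (N_L − N')
    have hnn : (0 : ℝ) ≤ (NL δ L : ℝ) - N' := by
      have : (N' : ℝ) ≤ (NL δ L : ℝ) := by exact_mod_cast hle
      linarith
    have hmono : μ * ((NL δ L : ℝ) - N') / (L : ℝ) ^ 2 ≤ μ₂ * ((NL δ L : ℝ) - N') / (L : ℝ) ^ 2 :=
      div_le_div_of_nonneg_right (mul_le_mul_of_nonneg_right hμm.2 hnn) hLpos.le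
    linarith
  · intro hle
    have hnp : (NL δ L : ℝ) - N' ≤ 0 := by
      have : (NL δ L : ℝ) ≤ (N' : ℝ) := by exact_mod_cast hle
      linarith
    have hmono : μ * ((NL δ L : ℝ) - N') / (L : ℝ) ^ 2 ≤ μ₁ * ((NL δ L : ℝ) - N') / (L : ℝ) ^ 2 :=
      div_le_div_of_nonneg_right (mul_le_mul_of_nonpos_right hμm.1 hnp) hLpos.le
    linarith

/-! ### Seed leverage — how far the mean-field seed can move any Rayleigh quotient -/

/-- `0 ≤ Re⟨ψ, P ψ⟩` (`P = ΔᴴΔ ≥ 0`). -/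
theorem re_rayleigh_seed_nonneg (L : ℕ) [NeZero L] (ψ : Fock (Orb (FermionTorus 2 L))) :
    0 ≤ (star ψ ⬝ᵥ seed L *ᵥ ψ).re := by
  have h := (pairField_conjTranspose_mul_self_posSemidef dWaveFormFactor L).re_dotProduct_nonneg ψ
  simpa using h

/-- `Re⟨ψ, P ψ⟩ ≤ ‖Δ_d‖²` for a unit vector (Cauchy–Schwarz and the C⋆-identity `‖ΔᴴΔ‖ = ‖Δ‖²`
for the `ℓ²`-operator norm). -/
theorem re_rayleigh_seed_le (L : ℕ) [NeZero L] {ψ : Fock (Orb (FermionTorus 2 L))}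
    (hψ : star ψ ⬝ᵥ ψ = 1) :
    (star ψ ⬝ᵥ seed L *ᵥ ψ).re ≤ ‖pairField dWaveFormFactor L‖ ^ 2 := by
  have h := re_star_dotProduct_mulVec_le_opNorm
    ((pairField dWaveFormFactor L)ᴴ * pairField dWaveFormFactor L) hψ
  rw [← Matrix.cstar_norm_def, Matrix.l2_opNorm_conjTranspose_mul_self, ← sq] at h
  exact h

/-- The numerical constant of `norm_pairField_le` for the `d`-wave form factor:
`(2 Σ_{e ∈ {0,±e₁,±e₂}} |d(e)/√2|)² = (4√2)² = 32`. -/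
theorem dWave_norm_const_sq :
    (2 * ∑ e ∈ insert (0 : Literature.Probability.LatticeModels.Site 2) unitSteps,
        |dWaveFormFactor e / Real.sqrt 2|) ^ 2 = 32 := by
  rw [Finset.sum_insert zero_not_mem_unitSteps, sum_unitSteps, dWaveFormFactor_zero,
    dWaveFormFactor_neg, dWaveFormFactor_neg, dWaveFormFactor_unitStep, dWaveFormFactor_unitStep]
  simp only [Fin.one_eq_zero_iff, if_true, OfNat.ofNat_ne_one, if_false, zero_div, abs_zero, zero_add]
  have hs : 0 < Real.sqrt 2 := Real.sqrt_pos.2 (by norm_num)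
  have h2 : Real.sqrt 2 ^ 2 = 2 := Real.sq_sqrt (by norm_num)
  rw [abs_of_pos (div_pos one_pos hs), abs_of_neg (by rw [neg_div]; exact neg_neg_of_pos (div_pos one_pos hs))]
  field_simp
  nlinarith [h2]

/-- `‖Δ_d‖² ≤ 32 L⁴`. -/
theorem norm_pairField_sq_le (L : ℕ) [NeZero L] :
    ‖pairField dWaveFormFactor L‖ ^ 2 ≤ 32 * ((L : ℝ) ^ 2) ^ 2 := by
  have h := norm_pairField_le dWaveFormFactor L
  have h0 : 0 ≤ ‖pairField dWaveFormFactor L‖ := norm_nonneg _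
  calc ‖pairField dWaveFormFactor L‖ ^ 2
      ≤ ((2 * ∑ e ∈ insert (0 : Literature.Probability.LatticeModels.Site 2) unitSteps,
          |dWaveFormFactor e / Real.sqrt 2|) * (L : ℝ) ^ 2) ^ 2 :=
        pow_le_pow_left₀ h0 h 2
    _ = 32 * ((L : ℝ) ^ 2) ^ 2 := by rw [mul_pow, dWave_norm_const_sq]

/-- **Seed leverage, pointwise**: `Re⟨ψ, Hcan ψ⟩ = Re⟨ψ, H₀ ψ⟩ − (g/L²) Re⟨ψ, P ψ⟩` with
`H₀ = hubbardTorus 2 L 1 U` the PURE repulsive Hubbard torus. -/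
theorem re_rayleigh_Hcan_eq (L : ℕ) [NeZero L] (U g : ℝ) (ψ : Fock (Orb (FermionTorus 2 L))) :
    (star ψ ⬝ᵥ Hcan L U g *ᵥ ψ).re =
      (star ψ ⬝ᵥ hubbardTorus 2 L 1 U *ᵥ ψ).re - g / (L : ℝ) ^ 2 * (star ψ ⬝ᵥ seed L *ᵥ ψ).re := by
  simp only [Hcan, sub_mulVec, smul_mulVec, dotProduct_sub, dotProduct_smul, Complex.sub_re,
    smul_eq_mul, Complex.re_ofReal_mul]

/-- The seed never RAISES a Rayleigh quotient (`g ≥ 0`): `Re⟨ψ,Hcan ψ⟩ ≤ Re⟨ψ,H₀ ψ⟩`. -/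
theorem re_rayleigh_Hcan_le_pure (L : ℕ) [NeZero L] {U g : ℝ} (hg : 0 ≤ g)
    (ψ : Fock (Orb (FermionTorus 2 L))) :
    (star ψ ⬝ᵥ Hcan L U g *ᵥ ψ).re ≤ (star ψ ⬝ᵥ hubbardTorus 2 L 1 U *ᵥ ψ).re := by
  rw [re_rayleigh_Hcan_eq]
  have h1 := re_rayleigh_seed_nonneg L ψ
  have h2 : 0 ≤ g / (L : ℝ) ^ 2 := div_nonneg hg (sq_nonneg _)
  nlinarith

/-- ... and LOWERS it by at most `32 g L²` on unit vectors: `Re⟨ψ,H₀ψ⟩ ≤ Re⟨ψ,Hcan ψ⟩ + 32 g L²`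
(`‖Δ_d‖ ≤ 4√2 L²`). So every energy DENSITY of the seeded model is within `32 g ≤ 3.2` of the pure
one: the crux's convexity content beyond the pure (short-range, automatically convex) model is a
perturbation of size ≤ 64 g per site. -/
theorem re_rayleigh_pure_le_Hcan_add (L : ℕ) [NeZero L] {U g : ℝ} (hg : 0 ≤ g)
    {ψ : Fock (Orb (FermionTorus 2 L))} (hψ : star ψ ⬝ᵥ ψ = 1) :
    (star ψ ⬝ᵥ hubbardTorus 2 L 1 U *ᵥ ψ).re ≤
      (star ψ ⬝ᵥ Hcan L U g *ᵥ ψ).re + 32 * g * (L : ℝ) ^ 2 := by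
  rw [re_rayleigh_Hcan_eq]
  have hL : (0 : ℝ) < (L : ℝ) ^ 2 := cast_sq_pos_of_neZero L
  have h1 : (star ψ ⬝ᵥ seed L *ᵥ ψ).re ≤ 32 * ((L : ℝ) ^ 2) ^ 2 :=
    (re_rayleigh_seed_le L hψ).trans (norm_pairField_sq_le L)
  have h2 : g / (L : ℝ) ^ 2 * (star ψ ⬝ᵥ seed L *ᵥ ψ).re ≤ g / (L : ℝ) ^ 2 * (32 * ((L : ℝ) ^ 2) ^ 2) :=
    mul_le_mul_of_nonneg_left h1 (div_nonneg hg hL.le)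
  have h3 : g / (L : ℝ) ^ 2 * (32 * ((L : ℝ) ^ 2) ^ 2) = 32 * g * (L : ℝ) ^ 2 := by
    field_simp
  linarith

/-- **Template A with PURE comparison states.** The crux bounds the SEEDED `N_L`-sector ground
energy by the mean PURE-model energy of any two unit vectors in sectors `N₁ + N₂ = 2N_L`
(Template A and `re_rayleigh_Hcan_le_pure`); with `re_rayleigh_pure_le_Hcan_add` on the left this
reads: pure midpoint defect at `N_L` ≤ 32 g + κ — consistent with the convexity theorem for the
short-range model, so a kill can only come from the ≤ 64 g mean-field window. -/
theorem crux_implies_mixedMidpointT0 (h : TwSeededEnsembleEquivalence) :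
    ∀ δ ∈ Set.Icc (1/10 : ℝ) (2/5 : ℝ), ∃ U₀ : ℝ, 0 < U₀ ∧ ∀ U ∈ Set.Ioc (0 : ℝ) U₀,
      ∀ g ∈ Set.Ioc (0 : ℝ) (1 / 10), ∀ κ : ℝ, 0 < κ → ∃ L₀ : ℕ, ∀ (L : ℕ) [NeZero L], L₀ ≤ L →
        ∀ (N₁ N₂ : ℕ) (ψ₁ ψ₂ : Fock (Orb (FermionTorus 2 L))), N₁ + N₂ = 2 * NL δ L →
          IsNParticle N₁ ψ₁ → IsNParticle N₂ ψ₂ → star ψ₁ ⬝ᵥ ψ₁ = 1 → star ψ₂ ⬝ᵥ ψ₂ = 1 →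
            (Hcan L U g).minEnergyOn (szSector (Λ := FermionTorus 2 L) (NL δ L) 0) / (L : ℝ) ^ 2 ≤
              ((star ψ₁ ⬝ᵥ hubbardTorus 2 L 1 U *ᵥ ψ₁).re +
                  (star ψ₂ ⬝ᵥ hubbardTorus 2 L 1 U *ᵥ ψ₂).re) / (2 * (L : ℝ) ^ 2) + κ := by
  intro δ hδ
  obtain ⟨U₀, hU₀, hU⟩ := crux_implies_midpointConvexT0 h δ hδ
  refine ⟨U₀, hU₀, fun U hUm g hg κ hκ => ?_⟩
  obtain ⟨L₀, hL₀⟩ := hU U hUm g hg κ hκ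
  refine ⟨L₀, fun L _ hL N₁ N₂ ψ₁ ψ₂ hsum hN₁ hN₂ hψ₁ hψ₂ => ?_⟩
  have hmain := hL₀ L hL N₁ N₂ ψ₁ ψ₂ hsum hN₁ hN₂ hψ₁ hψ₂
  have h1 := re_rayleigh_Hcan_le_pure L hg.1.le ψ₁ (U := U)
  have h2 := re_rayleigh_Hcan_le_pure L hg.1.le ψ₂ (U := U)
  have hL2 : (0 : ℝ) < 2 * (L : ℝ) ^ 2 := by have := cast_sq_pos_of_neZero L; linarith
  have hmono : ((star ψ₁ ⬝ᵥ Hcan L U g *ᵥ ψ₁).re + (star ψ₂ ⬝ᵥ Hcan L U g *ᵥ ψ₂).re) /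
      (2 * (L : ℝ) ^ 2) ≤ ((star ψ₁ ⬝ᵥ hubbardTorus 2 L 1 U *ᵥ ψ₁).re +
        (star ψ₂ ⬝ᵥ hubbardTorus 2 L 1 U *ᵥ ψ₂).re) / (2 * (L : ℝ) ^ 2) :=
    div_le_div_of_nonneg_right (by linarith) hL2.le
  linarith

/-! ### The recommended narrowing (no kill; glue-compatible) -/

/-- **C′ — the glue-compatible narrowing of the crux.** Same inequality, same μ-window depending on
`δ` only (so that `TwSourcedInertness` / `TwSourcedCondensation` can be instantiated on `[μ₁, μ₂]`
BEFORE the scale `a` is known), but the inverse temperature is capped at the Cooper ceiling the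
glue actually uses: `∀ a > 0, ∃ U₀(δ,a), ∀ U ≤ U₀, ∀ g, ∀ β ∈ [1, exp(a/U)]`. `TwRungGlue` goes
through verbatim with `β := exp(a/U)`, `a := min(aⁱ, aᶜ)`. What C′ removes: the corner
`β > exp(a/U)` at fixed `U` (T below every convergent-expansion window, where the crux silently
contains its own T = 0 instance, Template A), while keeping every instance the route consumes.
This is a RECOMMENDATION to the planner, not a refutation: no witness against the dropped corner is
known (mean-field theory has no density jump there either). -/
def CruxNarrow : Prop :=
  ∀ δ ∈ Set.Icc (1/10 : ℝ) (2/5 : ℝ), ∃ μ₁ μ₂ : ℝ, -4 < μ₁ ∧ μ₁ ≤ μ₂ ∧ μ₂ < 0 ∧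
    ∀ a : ℝ, 0 < a → ∃ U₀ : ℝ, 0 < U₀ ∧ ∀ U ∈ Set.Ioc (0 : ℝ) U₀, ∀ g ∈ Set.Ioc (0 : ℝ) (1 / 10),
      ∀ β : ℝ, 1 ≤ β → β ≤ Real.exp (a / U) → ∃ μ ∈ Set.Icc μ₁ μ₂, ∀ ε : ℝ, 0 < ε → ∃ L₀ : ℕ,
        ∀ (L : ℕ) [NeZero L], L₀ ≤ L →
          (Hcan L U g).minEnergyOn (szSector (Λ := FermionTorus 2 L) (NL δ L) 0) / (L : ℝ) ^ 2 +
              Real.log ((Hgc L U μ g).partitionFn β).re / (β * (L : ℝ) ^ 2) -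
              μ * (2 * (⌊(1 - δ) * (L : ℝ) ^ 2 / 2⌋₊ : ℝ)) / (L : ℝ) ^ 2 ≤ Real.log 4 / β + ε

/-- The crux implies its narrowing (drop the cap on `β`; `U₀` independent of `a`). -/
theorem cruxNarrow_of_crux (h : TwSeededEnsembleEquivalence) : CruxNarrow := by
  intro δ hδ
  obtain ⟨μ₁, μ₂, hμ₁, hμ₁₂, hμ₂, U₀, hU₀, hU⟩ := h δ hδ
  exact ⟨μ₁, μ₂, hμ₁, hμ₁₂, hμ₂, fun a _ => ⟨U₀, hU₀, fun U hUm g hg β hβ _ => hU U hUm g hg β hβ⟩⟩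

/-! ## Gen 3 — Template D (β-monotonicity) and Template C (the T = 0 normal form) -/

section Gen3

open Filter Topology

/-! ### Template D — β-monotonicity of the defect functional -/

/-- `Re Z_0(A) = dim`. -/
theorem partitionFn_zero_re {m : Type*} [Fintype m] [DecidableEq m] (A : Matrix m m ℂ) :
    (A.partitionFn 0).re = Fintype.card m := by
  simp [Matrix.partitionFn, Matrix.trace_one]

/-- **Chord inequality for `β ↦ log Z_β`** between `0` and `β'`, read at `β ∈ (0, β']`:
`β' log Z_β ≤ (β' − β) log dim + β log Z_{β'}` (convexity of `log Z` in `β`, from the tree's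
supporting-line form `log_partitionFn_sub_mul_energy_le`). [folklore] -/
theorem log_partitionFn_chord {m : Type*} [Fintype m] [DecidableEq m] [Nonempty m]
    {A : Matrix m m ℂ} (hA : A.IsHermitian) {β β' : ℝ} (hβ : 0 < β) (hle : β ≤ β') :
    β' * Real.log (A.partitionFn β).re ≤
      (β' - β) * Real.log (Fintype.card m) + β * Real.log (A.partitionFn β').re := by
  have h0 := log_partitionFn_sub_mul_energy_le hA 0 hβ
  have h1 := log_partitionFn_sub_mul_energy_le hA β' hβ
  rw [partitionFn_zero_re] at h0
  have h0' := mul_le_mul_of_nonneg_left h0 (sub_nonneg.2 hle)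
  have h1' := mul_le_mul_of_nonneg_left h1 hβ.le
  nlinarith [h0', h1']

/-- `log dim Fock = L² log 4` for the torus of side `L` (`dim = 2^{2L²}`). -/
theorem log_card_fock (L : ℕ) [NeZero L] :
    Real.log (Fintype.card (Finset (Orb (FermionTorus 2 L))) : ℝ) = (L : ℝ) ^ 2 * Real.log 4 := by
  rw [Fintype.card_finset, card_orb, card_fermionTorus]
  push_cast
  rw [Real.log_pow, show (4 : ℝ) = 2 ^ 2 by norm_num, Real.log_pow]
  push_cast
  ring

/-- **Template D (β-monotonicity).** For the grand-canonical seeded Hamiltonian at fixed `μ`, `L`: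
`β ↦ log Re Z_β /(β L²) − log 4/β` is non-decreasing on `(0, ∞)`. Hence the crux's defect
functional `e_L + p_L(β,μ) − μ n_L − log 4/β` is non-decreasing in `β`: an instance of the crux
inequality at `β'` implies it at every `β ≤ β'` with the SAME `μ, ε, L` — the crux is exactly its
`β → ∞` (T = 0) content, nothing thermal can be spent. [folklore] -/
theorem pressure_sub_allowance_mono (L : ℕ) [NeZero L] (U μ g : ℝ) {β β' : ℝ} (hβ : 0 < β)
    (hle : β ≤ β') :
    Real.log ((Hgc L U μ g).partitionFn β).re / (β * (L : ℝ) ^ 2) - Real.log 4 / β ≤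
      Real.log ((Hgc L U μ g).partitionFn β').re / (β' * (L : ℝ) ^ 2) - Real.log 4 / β' := by
  have hβ' : 0 < β' := lt_of_lt_of_le hβ hle
  have hL : (0 : ℝ) < (L : ℝ) ^ 2 := cast_sq_pos_of_neZero L
  have hL0 : (L : ℝ) ≠ 0 := by
    intro h0; rw [h0] at hL; simp at hL
  have chord := log_partitionFn_chord (isHermitian_Hgc L U μ g) hβ hle
  rw [log_card_fock] at chord
  set Zβ := Real.log ((Hgc L U μ g).partitionFn β).re
  set Zβ' := Real.log ((Hgc L U μ g).partitionFn β').re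
  have hnum : 0 ≤ (β' - β) * ((L : ℝ) ^ 2 * Real.log 4) + β * Zβ' - β' * Zβ := by linarith
  have key : Zβ' / (β' * (L : ℝ) ^ 2) - Real.log 4 / β' - (Zβ / (β * (L : ℝ) ^ 2) - Real.log 4 / β) =
      ((β' - β) * ((L : ℝ) ^ 2 * Real.log 4) + β * Zβ' - β' * Zβ) / (β * β' * (L : ℝ) ^ 2) := by
    field_simp
    ring
  have hpos : 0 < β * β' * (L : ℝ) ^ 2 := by positivity
  have := div_nonneg hnum hpos.le
  linarith [key]

/-- **Downward closure of crux instances in `β`.** If the crux inequality holds at `(β', μ, ε, L)`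
then it holds at `(β, μ, ε, L)` for every `0 < β ≤ β'`. -/
theorem cruxInstance_anti_beta (L : ℕ) [NeZero L] (U μ g A ν : ℝ) {β β' ε : ℝ} (hβ : 0 < β)
    (hle : β ≤ β')
    (h : A + Real.log ((Hgc L U μ g).partitionFn β').re / (β' * (L : ℝ) ^ 2) - ν ≤
      Real.log 4 / β' + ε) :
    A + Real.log ((Hgc L U μ g).partitionFn β).re / (β * (L : ℝ) ^ 2) - ν ≤ Real.log 4 / β + ε := by
  have := pressure_sub_allowance_mono L U μ g hβ hle
  linarith

/-! ### Template C — the T = 0 normal form (hull touch with slope in the window) -/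

/-- **T = 0 HULL TOUCH, weak form** (`∀ κ ∃ μ`): for every admissible `(U, g)` and every `κ > 0`
some `μ` in the `δ`-uniform window makes the `N_L`-sector ground energy of `Hcan − μN̂` exceed the
grand-canonical GROUND energy of `Hcan − μN̂` by at most `κ L²`, eventually in `L`. -/
def HullTouchT0 : Prop :=
  ∀ δ ∈ Set.Icc (1/10 : ℝ) (2/5 : ℝ), ∃ μ₁ μ₂ : ℝ, -4 < μ₁ ∧ μ₁ ≤ μ₂ ∧ μ₂ < 0 ∧ ∃ U₀ : ℝ, 0 < U₀ ∧
    ∀ U ∈ Set.Ioc (0 : ℝ) U₀, ∀ g ∈ Set.Ioc (0 : ℝ) (1 / 10), ∀ κ : ℝ, 0 < κ →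
      ∃ μ ∈ Set.Icc μ₁ μ₂, ∃ L₀ : ℕ, ∀ (L : ℕ) [NeZero L], L₀ ≤ L →
        (Hcan L U g).minEnergyOn (szSector (Λ := FermionTorus 2 L) (NL δ L) 0) - μ * (NL δ L : ℝ) ≤
          (Hgc L U μ g).groundEnergy + κ * (L : ℝ) ^ 2

/-- **T = 0 HULL TOUCH, strong form** (`∃ μ ∀ κ`): one `μ` in the window is an asymptotic
supporting slope of the seeded sector staircase at `N_L`. -/
def HullTouchT0Strong : Prop :=
  ∀ δ ∈ Set.Icc (1/10 : ℝ) (2/5 : ℝ), ∃ μ₁ μ₂ : ℝ, -4 < μ₁ ∧ μ₁ ≤ μ₂ ∧ μ₂ < 0 ∧ ∃ U₀ : ℝ, 0 < U₀ ∧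
    ∀ U ∈ Set.Ioc (0 : ℝ) U₀, ∀ g ∈ Set.Ioc (0 : ℝ) (1 / 10),
      ∃ μ ∈ Set.Icc μ₁ μ₂, ∀ κ : ℝ, 0 < κ → ∃ L₀ : ℕ, ∀ (L : ℕ) [NeZero L], L₀ ≤ L →
        (Hcan L U g).minEnergyOn (szSector (Λ := FermionTorus 2 L) (NL δ L) 0) - μ * (NL δ L : ℝ) ≤
          (Hgc L U μ g).groundEnergy + κ * (L : ℝ) ^ 2

/-- `−β E₀ ≤ log Re Z_β`. -/
theorem neg_mul_groundEnergy_le_log_partitionFn {m : Type*} [Fintype m] [DecidableEq m] [Nonempty m]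
    {A : Matrix m m ℂ} (hA : A.IsHermitian) (β : ℝ) :
    -(β * A.groundEnergy) ≤ Real.log (A.partitionFn β).re := by
  have h1 := exp_neg_mul_groundEnergy_le_partitionFn hA β
  calc -(β * A.groundEnergy) = Real.log (Real.exp (-(β * A.groundEnergy))) := (Real.log_exp _).symm
    _ ≤ Real.log (A.partitionFn β).re := Real.log_le_log (Real.exp_pos _) h1

/-- `log Re Z_β ≤ log dim − β E₀` for `β ≥ 0`. -/
theorem log_partitionFn_le {m : Type*} [Fintype m] [DecidableEq m] [Nonempty m]
    {A : Matrix m m ℂ} (hA : A.IsHermitian) {β : ℝ} (hβ : 0 ≤ β) :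
    Real.log (A.partitionFn β).re ≤ Real.log (Fintype.card m) - β * A.groundEnergy := by
  have h1 := partitionFn_le_card_mul_exp hA hβ
  have h0 : 0 < (A.partitionFn β).re :=
    lt_of_lt_of_le (Real.exp_pos _) (exp_neg_mul_groundEnergy_le_partitionFn hA β)
  have hc : (0 : ℝ) < Fintype.card m := by exact_mod_cast Fintype.card_pos
  calc Real.log (A.partitionFn β).re
      ≤ Real.log (Fintype.card m * Real.exp (-(β * A.groundEnergy))) := Real.log_le_log h0 h1
    _ = Real.log (Fintype.card m) - β * A.groundEnergy := by
        rw [Real.log_mul hc.ne' (Real.exp_pos _).ne', Real.log_exp]; ring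

/-- **crux ⇒ weak hull touch** (`β := max 1 (2 log 4/κ)`, `ε := κ/2`, `Z ≥ e^{−βE₀}`). -/
theorem hullTouchT0_of_crux (h : TwSeededEnsembleEquivalence) : HullTouchT0 := by
  intro δ hδ
  obtain ⟨μ₁, μ₂, hμ₁, hμ₁₂, hμ₂, U₀, hU₀, hU⟩ := h δ hδ
  refine ⟨μ₁, μ₂, hμ₁, hμ₁₂, hμ₂, U₀, hU₀, fun U hUm g hg κ hκ => ?_⟩
  set β : ℝ := max 1 (2 * Real.log 4 / κ) with hβdef
  have hβ1 : 1 ≤ β := le_max_left _ _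
  have hβpos : 0 < β := lt_of_lt_of_le one_pos hβ1
  have hlog4 : 0 < Real.log 4 := Real.log_pos (by norm_num)
  have hslack : Real.log 4 / β ≤ κ / 2 := by
    rw [div_le_iff₀ hβpos]
    have : 2 * Real.log 4 / κ ≤ β := le_max_right _ _
    rw [div_le_iff₀ hκ] at this
    linarith
  obtain ⟨μ, hμm, hμ⟩ := hU U hUm g hg β hβ1
  obtain ⟨L₀, hL₀⟩ := hμ (κ / 2) (by linarith)
  refine ⟨μ, hμm, L₀, fun L _ hL => ?_⟩
  have hcrux := hL₀ L hL
  have hLpos : (0 : ℝ) < (L : ℝ) ^ 2 := cast_sq_pos_of_neZero L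
  set Z := Real.log ((Hgc L U μ g).partitionFn β).re
  set A := (Hcan L U g).minEnergyOn (szSector (Λ := FermionTorus 2 L) (NL δ L) 0)
  set E₀ := (Hgc L U μ g).groundEnergy
  have hZ : -(β * E₀) ≤ Z := neg_mul_groundEnergy_le_log_partitionFn (isHermitian_Hgc L U μ g) β
  have hc : A / (L : ℝ) ^ 2 + Z / (β * (L : ℝ) ^ 2) - μ * (NL δ L : ℝ) / (L : ℝ) ^ 2 ≤
      Real.log 4 / β + κ / 2 := by
    rw [cast_NL]; exact hcrux
  -- Z/(βL²) ≥ −E₀/L²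
  have hL0 : (L : ℝ) ≠ 0 := fun h0 => by rw [h0] at hLpos; simp at hLpos
  have hZ' : -(E₀ / (L : ℝ) ^ 2) ≤ Z / (β * (L : ℝ) ^ 2) := by
    rw [le_div_iff₀ (mul_pos hβpos hLpos)]
    have : -(E₀ / (L : ℝ) ^ 2) * (β * (L : ℝ) ^ 2) = -(β * E₀) := by
      field_simp
    linarith
  have hmain : A / (L : ℝ) ^ 2 - E₀ / (L : ℝ) ^ 2 - μ * (NL δ L : ℝ) / (L : ℝ) ^ 2 ≤ κ := by linarith
  have : (A - E₀ - μ * (NL δ L : ℝ)) / (L : ℝ) ^ 2 ≤ κ := by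
    rw [sub_div, sub_div]; exact hmain
  rw [div_le_iff₀ hLpos] at this
  linarith

/-- **strong hull touch ⇒ crux** (`Z ≤ 4^{L²} e^{−βE₀}`; the same `μ` serves every `β ≥ 1`). -/
theorem crux_of_hullTouchT0Strong (h : HullTouchT0Strong) : TwSeededEnsembleEquivalence := by
  intro δ hδ
  obtain ⟨μ₁, μ₂, hμ₁, hμ₁₂, hμ₂, U₀, hU₀, hU⟩ := h δ hδ
  refine ⟨μ₁, μ₂, hμ₁, hμ₁₂, hμ₂, U₀, hU₀, fun U hUm g hg β hβ1 => ?_⟩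
  obtain ⟨μ, hμm, hμ⟩ := hU U hUm g hg
  refine ⟨μ, hμm, fun ε hε => ?_⟩
  obtain ⟨L₀, hL₀⟩ := hμ ε hε
  refine ⟨L₀, fun L _ hL => ?_⟩
  have hT := hL₀ L hL
  have hβpos : 0 < β := lt_of_lt_of_le one_pos hβ1
  have hLpos : (0 : ℝ) < (L : ℝ) ^ 2 := cast_sq_pos_of_neZero L
  have hL0 : (L : ℝ) ≠ 0 := fun h0 => by rw [h0] at hLpos; simp at hLpos
  set Z := Real.log ((Hgc L U μ g).partitionFn β).re
  set A := (Hcan L U g).minEnergyOn (szSector (Λ := FermionTorus 2 L) (NL δ L) 0)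
  set E₀ := (Hgc L U μ g).groundEnergy
  have hZ : Z ≤ (L : ℝ) ^ 2 * Real.log 4 - β * E₀ := by
    have := log_partitionFn_le (isHermitian_Hgc L U μ g) hβpos.le
    rwa [log_card_fock] at this
  have hZ' : Z / (β * (L : ℝ) ^ 2) ≤ Real.log 4 / β - E₀ / (L : ℝ) ^ 2 := by
    rw [div_le_iff₀ (mul_pos hβpos hLpos)]
    have : (Real.log 4 / β - E₀ / (L : ℝ) ^ 2) * (β * (L : ℝ) ^ 2) =
        (L : ℝ) ^ 2 * Real.log 4 - β * E₀ := by field_simp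
    linarith
  have hE : E₀ / (L : ℝ) ^ 2 ≥ (A - μ * (NL δ L : ℝ)) / (L : ℝ) ^ 2 - ε := by
    have h1 : (A - μ * (NL δ L : ℝ)) / (L : ℝ) ^ 2 ≤ (E₀ + ε * (L : ℝ) ^ 2) / (L : ℝ) ^ 2 :=
      div_le_div_of_nonneg_right hT hLpos.le
    have h2 : (E₀ + ε * (L : ℝ) ^ 2) / (L : ℝ) ^ 2 = E₀ / (L : ℝ) ^ 2 + ε := by
      field_simp
    linarith
  rw [← cast_NL]
  have h3 : (A - μ * (NL δ L : ℝ)) / (L : ℝ) ^ 2 = A / (L : ℝ) ^ 2 - μ * (NL δ L : ℝ) / (L : ℝ) ^ 2 := by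
    rw [sub_div]
  linarith

section Generic

variable {Λ : Type*} [LinearOrder Λ] [Fintype Λ]

/-- `0 ≤ Re ω_A(N̂) ≤ 2|Λ|` for the tracial ground state of any Hermitian `A` (generic lattice;
`0 ≤ N̂ ≤ 2|Λ|` from the tree). [folklore] -/
theorem re_groundStateFunctional_totalNumber_mem_Icc
    {A : Matrix (Finset (Orb Λ)) (Finset (Orb Λ)) ℂ} (hA : A.IsHermitian) :
    (A.groundStateFunctional totalNumber).re ∈ Set.Icc (0 : ℝ) (2 * Fintype.card Λ) := by
  constructor
  · have h := groundStateFunctional_nonneg_of_posSemidef A (posSemidef_totalNumber (Λ := Λ))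
    exact (Complex.nonneg_iff.mp h).1
  · have h := groundStateFunctional_nonneg_of_posSemidef A
      (posSemidef_two_mul_card_sub_totalNumber (Λ := Λ))
    rw [map_sub, map_smul, groundStateFunctional_one hA] at h
    obtain ⟨hre, -⟩ := Complex.nonneg_iff.mp h
    simp only [Complex.sub_re, smul_eq_mul, mul_one, Complex.natCast_re] at hre
    have : (((2 * Fintype.card Λ : ℕ) : ℝ)) = 2 * Fintype.card Λ := by push_cast; ring
    linarith

/-- **`μ ↦ E₀(K − μN̂)` is `2|Λ|`-Lipschitz** for Hermitian `K` (Hellmann–Feynman supergradient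
inequality of the tree, `sub_mul_re_groundStateFunctional_le`, and `0 ≤ N̂ ≤ 2|Λ|`). [folklore] -/
theorem abs_groundEnergy_sub_smul_totalNumber_le
    {K : Matrix (Finset (Orb Λ)) (Finset (Orb Λ)) ℂ} (hK : K.IsHermitian) (μ μ' : ℝ) :
    |(K - (μ : ℂ) • totalNumber).groundEnergy - (K - (μ' : ℂ) • totalNumber).groundEnergy| ≤
      2 * Fintype.card Λ * |μ - μ'| := by
  have hO : (totalNumber : Matrix (Finset (Orb Λ)) _ ℂ).IsHermitian := totalNumber_isHermitian
  have h1 := sub_mul_re_groundStateFunctional_le hK hO μ μ'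
  have h2 := sub_mul_re_groundStateFunctional_le hK hO μ' μ
  obtain ⟨hn0, hn2⟩ := re_groundStateFunctional_totalNumber_mem_Icc (isHermitian_sub_real_smul hK hO μ)
  obtain ⟨hn0', hn2'⟩ :=
    re_groundStateFunctional_totalNumber_mem_Icc (isHermitian_sub_real_smul hK hO μ')
  set n := ((K - (μ : ℂ) • totalNumber).groundStateFunctional totalNumber).re
  set n' := ((K - (μ' : ℂ) • totalNumber).groundStateFunctional totalNumber).re
  have hc : (0 : ℝ) ≤ 2 * Fintype.card Λ := by positivity
  rw [abs_le]
  constructor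
  · have : (μ - μ') * n ≤ 2 * Fintype.card Λ * |μ - μ'| := by
      calc (μ - μ') * n ≤ |μ - μ'| * n := mul_le_mul_of_nonneg_right (le_abs_self _) hn0
        _ ≤ |μ - μ'| * (2 * Fintype.card Λ) := mul_le_mul_of_nonneg_left hn2 (abs_nonneg _)
        _ = 2 * Fintype.card Λ * |μ - μ'| := by ring
    nlinarith
  · have : (μ' - μ) * n' ≤ 2 * Fintype.card Λ * |μ - μ'| := by
      calc (μ' - μ) * n' ≤ |μ' - μ| * n' := mul_le_mul_of_nonneg_right (le_abs_self _) hn0'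
        _ ≤ |μ' - μ| * (2 * Fintype.card Λ) := mul_le_mul_of_nonneg_left hn2' (abs_nonneg _)
        _ = 2 * Fintype.card Λ * |μ - μ'| := by rw [abs_sub_comm]; ring
    nlinarith

end Generic

/-- **`μ ↦ E₀(Hcan − μN̂)` is `2L²`-Lipschitz** on the torus of side `L`. -/
theorem abs_groundEnergy_Hgc_sub_le (L : ℕ) [NeZero L] (U g μ μ' : ℝ) :
    |(Hgc L U μ g).groundEnergy - (Hgc L U μ' g).groundEnergy| ≤ 2 * (L : ℝ) ^ 2 * |μ - μ'| := by
  have h := abs_groundEnergy_sub_smul_totalNumber_le (isHermitian_Hcan L U g) μ μ'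
  rw [card_fermionTorus] at h
  push_cast at h
  rw [Hgc_eq, Hgc_eq]
  convert h

/-- `N_L ≤ L²`. -/
theorem NL_le (δ : ℝ) (hδ : δ ∈ Set.Icc (1/10 : ℝ) (2/5 : ℝ)) (L : ℕ) : (NL δ L : ℝ) ≤ (L : ℝ) ^ 2 := by
  rw [cast_NL]
  have h1 : (⌊(1 - δ) * (L : ℝ) ^ 2 / 2⌋₊ : ℝ) ≤ (1 - δ) * (L : ℝ) ^ 2 / 2 := by
    apply Nat.floor_le
    have : 0 ≤ (1 - δ) := by linarith [hδ.2]
    positivity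
  have hL : (0 : ℝ) ≤ (L : ℝ) ^ 2 := sq_nonneg _
  nlinarith [hδ.1]

/-- **Compactness upgrade: weak hull touch ⇒ strong hull touch** (Bolzano–Weierstrass in the
compact window plus the `2L²`-Lipschitz bound in `μ`; `N_L ≤ L²`). -/
theorem hullTouchT0Strong_of_hullTouchT0 (h : HullTouchT0) : HullTouchT0Strong := by
  intro δ hδ
  obtain ⟨μ₁, μ₂, hμ₁, hμ₁₂, hμ₂, U₀, hU₀, hU⟩ := h δ hδ
  refine ⟨μ₁, μ₂, hμ₁, hμ₁₂, hμ₂, U₀, hU₀, fun U hUm g hg => ?_⟩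
  have hseq : ∀ n : ℕ, ∃ μ ∈ Set.Icc μ₁ μ₂, ∃ L₀ : ℕ, ∀ (L : ℕ) [NeZero L], L₀ ≤ L →
      (Hcan L U g).minEnergyOn (szSector (Λ := FermionTorus 2 L) (NL δ L) 0) - μ * (NL δ L : ℝ) ≤
        (Hgc L U μ g).groundEnergy + (1 / ((n : ℝ) + 1)) * (L : ℝ) ^ 2 :=
    fun n => hU U hUm g hg (1 / ((n : ℝ) + 1)) (by positivity)
  choose μs hμs L₀ hL₀ using hseq
  obtain ⟨μ, hμm, φ, hφ, hlim⟩ := isCompact_Icc.tendsto_subseq hμs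
  refine ⟨μ, hμm, fun κ hκ => ?_⟩
  -- pick n large: 1/(φ n + 1) ≤ κ/2 and |μs (φ n) − μ| ≤ κ/6
  obtain ⟨N₁, hN₁⟩ := Metric.tendsto_atTop.1 hlim (κ / 6) (by positivity)
  obtain ⟨N₂, hN₂⟩ := exists_nat_gt (2 / κ)
  set n := max N₁ N₂ with hn
  have hdist : dist (μs (φ n)) μ < κ / 6 := hN₁ n (le_max_left _ _)
  have hφn : (N₂ : ℝ) ≤ (φ n : ℝ) := by
    have : N₂ ≤ φ n := (le_max_right _ _).trans (hφ.id_le n)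
    exact_mod_cast this
  have hsmall : 1 / ((φ n : ℝ) + 1) ≤ κ / 2 := by
    rw [div_le_div_iff₀ (by positivity) (by positivity)]
    have : 2 / κ < (φ n : ℝ) + 1 := by linarith
    rw [div_lt_iff₀ hκ] at this
    linarith
  refine ⟨L₀ (φ n), fun L _ hL => ?_⟩
  have hT := hL₀ (φ n) L hL
  have hLip := abs_groundEnergy_Hgc_sub_le L U g (μs (φ n)) μ
  have hNL := NL_le δ hδ L
  have hNL0 : (0 : ℝ) ≤ (NL δ L : ℝ) := Nat.cast_nonneg _
  have hL2 : (0 : ℝ) ≤ (L : ℝ) ^ 2 := sq_nonneg _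
  have hd : |μs (φ n) - μ| < κ / 6 := by rwa [Real.dist_eq] at hdist
  rw [abs_lt] at hd
  rw [abs_le] at hLip
  set A := (Hcan L U g).minEnergyOn (szSector (Λ := FermionTorus 2 L) (NL δ L) 0)
  -- A − μ N_L = (A − μs N_L) + (μs − μ) N_L ≤ E₀(μs) + L²/(φ n+1) + |μs−μ| N_L
  --            ≤ E₀(μ) + 2L²|μs − μ| + L² κ/2 + |μs − μ| L²
  have h1 : (μs (φ n) - μ) * (NL δ L : ℝ) ≤ κ / 6 * (L : ℝ) ^ 2 := by
    calc (μs (φ n) - μ) * (NL δ L : ℝ) ≤ (κ / 6) * (NL δ L : ℝ) :=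
          mul_le_mul_of_nonneg_right hd.2.le hNL0
      _ ≤ κ / 6 * (L : ℝ) ^ 2 := mul_le_mul_of_nonneg_left hNL (by positivity)
  have h2 : 2 * (L : ℝ) ^ 2 * |μs (φ n) - μ| ≤ 2 * (L : ℝ) ^ 2 * (κ / 6) := by
    refine mul_le_mul_of_nonneg_left ?_ (by positivity)
    rw [abs_le]; constructor <;> linarith
  have h3 : 1 / ((φ n : ℝ) + 1) * (L : ℝ) ^ 2 ≤ κ / 2 * (L : ℝ) ^ 2 :=
    mul_le_mul_of_nonneg_right hsmall hL2
  nlinarith [hLip.1, hLip.2, h1, h2, h3, hT]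

/-- **Template C, the T = 0 normal form of the crux.** -/
theorem crux_iff_hullTouchT0 : TwSeededEnsembleEquivalence ↔ HullTouchT0 :=
  ⟨hullTouchT0_of_crux, fun h => crux_of_hullTouchT0Strong (hullTouchT0Strong_of_hullTouchT0 h)⟩

theorem crux_iff_hullTouchT0Strong : TwSeededEnsembleEquivalence ↔ HullTouchT0Strong :=
  ⟨fun h => hullTouchT0Strong_of_hullTouchT0 (hullTouchT0_of_crux h), crux_of_hullTouchT0Strong⟩

/-- **Template C, kill form.** An asymptotic T = 0 HULL GAP refutes the crux: some `δ` in the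
window such that for EVERY candidate window `[μ₁, μ₂] ⊂ (−4, 0)` and every `U₀ > 0` there are
admissible `U ≤ U₀`, `g ≤ 1/10` such that every slope `μ ∈ [μ₁, μ₂]` misses the `N_L` sector by a
macroscopic amount along a subsequence of `L`:
`E_{N_L}(U,g) − μ N_L > E₀(Hcan(U,g) − μN̂) + κ L²`. (This is the COMPLETE list of what can kill
the crux: by `crux_iff_hullTouchT0Strong` the converse holds too.) -/
theorem not_crux_of_hullGapT0
    (hgap : ∃ δ ∈ Set.Icc (1/10 : ℝ) (2/5 : ℝ), ∀ μ₁ μ₂ : ℝ, -4 < μ₁ → μ₁ ≤ μ₂ → μ₂ < 0 →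
      ∀ U₀ : ℝ, 0 < U₀ → ∃ U ∈ Set.Ioc (0 : ℝ) U₀, ∃ g ∈ Set.Ioc (0 : ℝ) (1 / 10),
        ∀ μ ∈ Set.Icc μ₁ μ₂, ∃ κ : ℝ, 0 < κ ∧ ∀ L₀ : ℕ, ∃ (L : ℕ) (_ : NeZero L), L₀ ≤ L ∧
          (Hgc L U μ g).groundEnergy + κ * (L : ℝ) ^ 2 <
            (Hcan L U g).minEnergyOn (szSector (Λ := FermionTorus 2 L) (NL δ L) 0) - μ * (NL δ L : ℝ)) :
    ¬ TwSeededEnsembleEquivalence := by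
  intro h
  obtain ⟨δ, hδ, hbad⟩ := hgap
  obtain ⟨μ₁, μ₂, hμ₁, hμ₁₂, hμ₂, U₀, hU₀, hgood⟩ := (crux_iff_hullTouchT0Strong.1 h) δ hδ
  obtain ⟨U, hU, g, hg, hμ⟩ := hbad μ₁ μ₂ hμ₁ hμ₁₂ hμ₂ U₀ hU₀
  obtain ⟨μ, hμm, hT⟩ := hgood U hU g hg
  obtain ⟨κ, hκ, hL⟩ := hμ μ hμm
  obtain ⟨L₀, hL₀⟩ := hT κ hκ
  obtain ⟨L, hLnz, hLle, hlt⟩ := hL L₀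
  have := hL₀ L hLle
  linarith

/-- The two failure descriptions are equivalent: `¬ crux ↔ ¬ HullTouchT0Strong` (and
`↔ ¬ HullTouchT0`). -/
theorem not_crux_iff_not_hullTouchT0Strong : ¬ TwSeededEnsembleEquivalence ↔ ¬ HullTouchT0Strong :=
  not_congr crux_iff_hullTouchT0Strong

/-- `¬ HullTouchT0Strong` unfolded by `push_neg` (the shape a disprover must exhibit). -/
theorem not_hullTouchT0Strong_iff :
    ¬ HullTouchT0Strong ↔
      ∃ δ ∈ Set.Icc (1/10 : ℝ) (2/5 : ℝ), ∀ μ₁ μ₂ : ℝ, -4 < μ₁ → μ₁ ≤ μ₂ → μ₂ < 0 →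
        ∀ U₀ : ℝ, 0 < U₀ → ∃ U ∈ Set.Ioc (0 : ℝ) U₀, ∃ g ∈ Set.Ioc (0 : ℝ) (1 / 10),
          ∀ μ ∈ Set.Icc μ₁ μ₂, ∃ κ : ℝ, 0 < κ ∧ ∀ L₀ : ℕ, ∃ (L : ℕ) (_ : NeZero L), L₀ ≤ L ∧
            (Hgc L U μ g).groundEnergy + κ * (L : ℝ) ^ 2 <
              (Hcan L U g).minEnergyOn (szSector (Λ := FermionTorus 2 L) (NL δ L) 0) -
                μ * (NL δ L : ℝ) := by
  unfold HullTouchT0Strong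
  push Not
  rfl


/-! ### Template E — seed transfer of the hull gap -/

/-- Rayleigh quotients of `Hcan` are non-increasing in the seed. -/
theorem re_rayleigh_Hcan_anti (L : ℕ) [NeZero L] (U : ℝ) {g₀ g : ℝ} (hg : g₀ ≤ g)
    (ψ : Fock (Orb (FermionTorus 2 L))) :
    (star ψ ⬝ᵥ Hcan L U g *ᵥ ψ).re ≤ (star ψ ⬝ᵥ Hcan L U g₀ *ᵥ ψ).re := by
  rw [re_rayleigh_Hcan_eq, re_rayleigh_Hcan_eq]
  have hP := re_rayleigh_seed_nonneg L ψ
  have hL : (0 : ℝ) < (L : ℝ) ^ 2 := cast_sq_pos_of_neZero L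
  have : g₀ / (L : ℝ) ^ 2 ≤ g / (L : ℝ) ^ 2 := div_le_div_of_nonneg_right hg hL.le
  nlinarith

/-- **Sector energies of `Hcan` are non-increasing in the seed** (`K ≠ ⊥`). -/
theorem minEnergyOn_Hcan_anti (L : ℕ) [NeZero L] (U : ℝ) {g₀ g : ℝ} (hg : g₀ ≤ g)
    (K : Submodule ℂ (Fock (Orb (FermionTorus 2 L)))) (hK : K ≠ ⊥) :
    (Hcan L U g).minEnergyOn K ≤ (Hcan L U g₀).minEnergyOn K := by
  obtain ⟨v, hvK, hv0⟩ := (Submodule.ne_bot_iff K).1 hK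
  obtain ⟨c, -, hc1⟩ := exists_smul_unit hv0
  refine le_csInf ⟨_, c • v, K.smul_mem c hvK, hc1, rfl⟩ ?_
  rintro E ⟨φ, hφK, hφ1, rfl⟩
  exact (minEnergyOn_le_rayleigh_of_mem (isHermitian_Hcan L U g) K hφK hφ1).trans
    (re_rayleigh_Hcan_anti L U hg φ)

/-- `Hgc(g₀) − Hgc(g) = ((g − g₀)/L²) P`. -/
theorem Hgc_sub_Hgc (L : ℕ) [NeZero L] (U μ g₀ g : ℝ) :
    Hgc L U μ g₀ - Hgc L U μ g = (((g - g₀) / (L : ℝ) ^ 2 : ℝ) : ℂ) • seed L := by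
  simp only [Hgc]
  rw [sub_sub_sub_cancel_left, ← sub_smul]
  congr 1
  push_cast
  ring

/-- **`E₀(Hgc)` is non-increasing in the seed** (Loewner monotonicity). -/
theorem groundEnergy_Hgc_anti (L : ℕ) [NeZero L] (U μ : ℝ) {g₀ g : ℝ} (hg : g₀ ≤ g) :
    (Hgc L U μ g).groundEnergy ≤ (Hgc L U μ g₀).groundEnergy := by
  refine groundEnergy_mono_of_posSemidef_sub (isHermitian_Hgc L U μ g) (isHermitian_Hgc L U μ g₀) ?_
  rw [Hgc_sub_Hgc]
  refine (pairField_conjTranspose_mul_self_posSemidef dWaveFormFactor L).smul ?_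
  have hL : (0 : ℝ) < (L : ℝ) ^ 2 := cast_sq_pos_of_neZero L
  exact Complex.zero_le_real.2 (div_nonneg (sub_nonneg.2 hg) hL.le)

/-- **Seed response of `E₀(Hgc)` is at most `32 (g − g₀) L²`** (trial state = ground state at `g`). -/
theorem groundEnergy_Hgc_le_add (L : ℕ) [NeZero L] (U μ : ℝ) {g₀ g : ℝ} (hg : g₀ ≤ g) :
    (Hgc L U μ g₀).groundEnergy ≤ (Hgc L U μ g).groundEnergy + 32 * (g - g₀) * (L : ℝ) ^ 2 := by
  obtain ⟨ψ, hψ1, hray⟩ := Matrix.exists_groundState_unit (isHermitian_Hgc L U μ g)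
  have htrial := groundEnergy_le_rayleigh_holds (isHermitian_Hgc L U μ g₀) ψ hψ1
  have hdecomp : Hgc L U μ g₀ = Hgc L U μ g + (((g - g₀) / (L : ℝ) ^ 2 : ℝ) : ℂ) • seed L := by
    rw [← Hgc_sub_Hgc L U μ g₀ g, add_sub_cancel]
  have hsplit : (star ψ ⬝ᵥ Hgc L U μ g₀ *ᵥ ψ).re =
      (Hgc L U μ g).groundEnergy + (g - g₀) / (L : ℝ) ^ 2 * (star ψ ⬝ᵥ seed L *ᵥ ψ).re := by
    rw [hdecomp, add_mulVec, dotProduct_add, Complex.add_re, hray, smul_mulVec, dotProduct_smul,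
      smul_eq_mul, Complex.re_ofReal_mul]
  rw [hsplit] at htrial
  have hL : (0 : ℝ) < (L : ℝ) ^ 2 := cast_sq_pos_of_neZero L
  have hP : (star ψ ⬝ᵥ seed L *ᵥ ψ).re ≤ 32 * ((L : ℝ) ^ 2) ^ 2 :=
    (re_rayleigh_seed_le L hψ1).trans (norm_pairField_sq_le L)
  have hcoef : 0 ≤ (g - g₀) / (L : ℝ) ^ 2 := div_nonneg (sub_nonneg.2 hg) hL.le
  have h2 : (g - g₀) / (L : ℝ) ^ 2 * (star ψ ⬝ᵥ seed L *ᵥ ψ).re ≤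
      (g - g₀) / (L : ℝ) ^ 2 * (32 * ((L : ℝ) ^ 2) ^ 2) := mul_le_mul_of_nonneg_left hP hcoef
  have h3 : (g - g₀) / (L : ℝ) ^ 2 * (32 * ((L : ℝ) ^ 2) ^ 2) = 32 * (g - g₀) * (L : ℝ) ^ 2 := by
    field_simp
  linarith

/-- **Template E (seed transfer of the T = 0 hull gap).** For `g₀ ≤ g`, every `μ, ν` and every
sector `K ≠ ⊥`: `Gap(g) ≤ Gap(g₀) + [E₀(Hgc g₀) − E₀(Hgc g)]`, the bracket being the (nonnegative)
grand-canonical ground-energy seed response. -/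
theorem hullGap_seed_transfer (L : ℕ) [NeZero L] (U μ ν : ℝ) {g₀ g : ℝ} (hg : g₀ ≤ g)
    (K : Submodule ℂ (Fock (Orb (FermionTorus 2 L)))) (hK : K ≠ ⊥) :
    (Hcan L U g).minEnergyOn K - ν - (Hgc L U μ g).groundEnergy ≤
      ((Hcan L U g₀).minEnergyOn K - ν - (Hgc L U μ g₀).groundEnergy) +
        ((Hgc L U μ g₀).groundEnergy - (Hgc L U μ g).groundEnergy) := by
  have h := minEnergyOn_Hcan_anti L U hg K hK
  linarith

/-- **Template E, numerical form**: `Gap(g) ≤ Gap(g₀) + 32 (g − g₀) L²`. Relative to the pure model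
(`g₀ → 0⁺`) a kill margin at seed `g` is `< 32 g` per site. -/
theorem hullGap_le_hullGap_add (L : ℕ) [NeZero L] (U μ ν : ℝ) {g₀ g : ℝ} (hg : g₀ ≤ g)
    (K : Submodule ℂ (Fock (Orb (FermionTorus 2 L)))) (hK : K ≠ ⊥) :
    (Hcan L U g).minEnergyOn K - ν - (Hgc L U μ g).groundEnergy ≤
      ((Hcan L U g₀).minEnergyOn K - ν - (Hgc L U μ g₀).groundEnergy) + 32 * (g - g₀) * (L : ℝ) ^ 2 := by
  have h1 := hullGap_seed_transfer L U μ ν hg K hK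
  have h2 := groundEnergy_Hgc_le_add L U μ hg
  linarith

end Gen3

/-! ## Gen 4 — Template F (coupling transfer) and Template H (the defect floor: the allowance is load-bearing) -/

section Gen4

open Literature.Probability.LatticeModels

/-! ### Template F — coupling (`U`) transfer

`W = Σ_x n_{x↑} n_{x↓}` satisfies `0 ≤ W`, `‖W‖ ≤ L²`, and `Hcan(U') − Hcan(U) = (U' − U) W`: every Rayleigh
quotient, every sector energy and the grand-canonical ground energy of the seeded model is non-decreasing in `U`
and moves by at most `(U' − U)L²`; the T = 0 hull gap of Template C is `L²`-Lipschitz in `U`. Relative to the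
`U = 0` seeded model (the reduced d-wave BCS model: AHM-solvable, no grand-canonical density jump at ANY seed by
strict convexity of the Bogoliubov functional in `s = |Δ|²`, drefute + kit j005281/j005486) a kill at repulsion `U`
therefore has margin `≤ U` per site — with Template E (`≤ 32 g` over the pure model) every counterexample lives in
the `O(U) ∩ O(g)` correlation window at `T = 0`. Def-free copy: `Negative/CouplingTransfer.lean`. -/

/-- `Hcan(U', g) − Hcan(U, g) = (U' − U) W`. -/
theorem Hcan_sub_Hcan_U (L : ℕ) [NeZero L] (U U' g : ℝ) :
    Hcan L U' g - Hcan L U g = ((U' - U : ℝ) : ℂ) • ∑ x : FermionTorus 2 L, numberOp x 0 * numberOp x 1 := by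
  have h := hamiltonianWith_sub_hamiltonianWith (fermionTorusGraph 2 L) 1 U U' 0
  change hubbardTorusWith 2 L 1 U' 0 - hubbardTorusWith 2 L 1 U 0 = _ at h
  rw [hubbardTorusWith_zero, hubbardTorusWith_zero] at h
  simp only [Hcan]
  rw [sub_sub_sub_cancel_right, h]

/-- `Hgc(U', μ, g) − Hgc(U, μ, g) = (U' − U) W`. -/
theorem Hgc_sub_Hgc_U (L : ℕ) [NeZero L] (U U' μ g : ℝ) :
    Hgc L U' μ g - Hgc L U μ g = ((U' - U : ℝ) : ℂ) • ∑ x : FermionTorus 2 L, numberOp x 0 * numberOp x 1 := by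
  have h := hamiltonianWith_sub_hamiltonianWith (fermionTorusGraph 2 L) 1 U U' μ
  change hubbardTorusWith 2 L 1 U' μ - hubbardTorusWith 2 L 1 U μ = _ at h
  simp only [Hgc]
  rw [sub_sub_sub_cancel_right, h]

/-- `‖W‖ ≤ L²`. -/
theorem norm_interaction_le (L : ℕ) [NeZero L] :
    ‖(∑ x : FermionTorus 2 L, numberOp x 0 * numberOp x 1 :
      Matrix (Finset (Orb (FermionTorus 2 L))) (Finset (Orb (FermionTorus 2 L))) ℂ)‖ ≤ (L : ℝ) ^ 2 := by
  calc ‖∑ x : FermionTorus 2 L,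
        (numberOp x 0 * numberOp x 1 : Matrix (Finset (Orb (FermionTorus 2 L))) (Finset (Orb (FermionTorus 2 L))) ℂ)‖
      ≤ ∑ x : FermionTorus 2 L,
        ‖(numberOp x 0 * numberOp x 1 : Matrix (Finset (Orb (FermionTorus 2 L))) (Finset (Orb (FermionTorus 2 L))) ℂ)‖ :=
        norm_sum_le _ _
    _ ≤ ∑ _x : FermionTorus 2 L, (1 : ℝ) := Finset.sum_le_sum fun x _ =>
        (norm_mul_le _ _).trans (mul_le_one₀ (norm_numberOp_le_one x 0) (norm_nonneg _) (norm_numberOp_le_one x 1))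
    _ = (L : ℝ) ^ 2 := by
        rw [Finset.sum_const, Finset.card_univ, card_fermionTorus, nsmul_eq_mul, mul_one]; push_cast; ring

/-- `0 ≤ Re⟨ψ, Wψ⟩ ≤ L²` on unit vectors. -/
theorem re_rayleigh_interaction_mem_Icc (L : ℕ) [NeZero L] {ψ : Fock (Orb (FermionTorus 2 L))}
    (hψ : star ψ ⬝ᵥ ψ = 1) :
    (star ψ ⬝ᵥ (∑ x : FermionTorus 2 L, numberOp x 0 * numberOp x 1) *ᵥ ψ).re ∈ Set.Icc (0 : ℝ) ((L : ℝ) ^ 2) := by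
  constructor
  · have h := (posSemidef_sum_numberOp_mul_numberOp (Λ := FermionTorus 2 L)).re_dotProduct_nonneg ψ
    simpa using h
  · exact (re_star_dotProduct_mulVec_le_opNorm _ hψ).trans (norm_interaction_le L)

/-- Rayleigh quotients of `Hcan` are non-decreasing in `U` … -/
theorem re_rayleigh_Hcan_mono_U (L : ℕ) [NeZero L] {U U' : ℝ} (hU : U ≤ U') (g : ℝ)
    (ψ : Fock (Orb (FermionTorus 2 L))) :
    (star ψ ⬝ᵥ Hcan L U g *ᵥ ψ).re ≤ (star ψ ⬝ᵥ Hcan L U' g *ᵥ ψ).re := by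
  rw [(sub_eq_iff_eq_add.1 (Hcan_sub_Hcan_U L U U' g)), add_mulVec, dotProduct_add, Complex.add_re, smul_mulVec,
    dotProduct_smul, smul_eq_mul, Complex.re_ofReal_mul]
  have h := (posSemidef_sum_numberOp_mul_numberOp (Λ := FermionTorus 2 L)).re_dotProduct_nonneg ψ
  have h' : 0 ≤ (star ψ ⬝ᵥ (∑ x : FermionTorus 2 L, numberOp x 0 * numberOp x 1) *ᵥ ψ).re := by simpa using h
  nlinarith [sub_nonneg.2 hU]

/-- … and move by at most `(U' − U)L²` on unit vectors. -/
theorem re_rayleigh_Hcan_le_add_U (L : ℕ) [NeZero L] {U U' : ℝ} (hU : U ≤ U') (g : ℝ)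
    {ψ : Fock (Orb (FermionTorus 2 L))} (hψ : star ψ ⬝ᵥ ψ = 1) :
    (star ψ ⬝ᵥ Hcan L U' g *ᵥ ψ).re ≤ (star ψ ⬝ᵥ Hcan L U g *ᵥ ψ).re + (U' - U) * (L : ℝ) ^ 2 := by
  rw [(sub_eq_iff_eq_add.1 (Hcan_sub_Hcan_U L U U' g)), add_mulVec, dotProduct_add, Complex.add_re, smul_mulVec,
    dotProduct_smul, smul_eq_mul, Complex.re_ofReal_mul]
  have h := (re_rayleigh_interaction_mem_Icc L hψ).2
  nlinarith [sub_nonneg.2 hU]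

/-- **Sector energies of `Hcan` are non-decreasing in `U`** (`K ≠ ⊥`) … -/
theorem minEnergyOn_Hcan_mono_U (L : ℕ) [NeZero L] {U U' : ℝ} (hU : U ≤ U') (g : ℝ)
    (K : Submodule ℂ (Fock (Orb (FermionTorus 2 L)))) (hK : K ≠ ⊥) :
    (Hcan L U g).minEnergyOn K ≤ (Hcan L U' g).minEnergyOn K := by
  obtain ⟨v, hvK, hv0⟩ := (Submodule.ne_bot_iff K).1 hK
  obtain ⟨c, -, hc1⟩ := exists_smul_unit hv0
  refine le_csInf ⟨_, c • v, K.smul_mem c hvK, hc1, rfl⟩ ?_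
  rintro E ⟨φ, hφK, hφ1, rfl⟩
  exact (minEnergyOn_le_rayleigh_of_mem (isHermitian_Hcan L U g) K hφK hφ1).trans (re_rayleigh_Hcan_mono_U L hU g φ)

/-- … and move by at most `(U' − U)L²`. -/
theorem minEnergyOn_Hcan_le_add_U (L : ℕ) [NeZero L] {U U' : ℝ} (hU : U ≤ U') (g : ℝ)
    (K : Submodule ℂ (Fock (Orb (FermionTorus 2 L)))) (hK : K ≠ ⊥) :
    (Hcan L U' g).minEnergyOn K ≤ (Hcan L U g).minEnergyOn K + (U' - U) * (L : ℝ) ^ 2 := by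
  obtain ⟨v, hvK, hv0⟩ := (Submodule.ne_bot_iff K).1 hK
  obtain ⟨c, -, hc1⟩ := exists_smul_unit hv0
  rw [← sub_le_iff_le_add]
  refine le_csInf ⟨_, c • v, K.smul_mem c hvK, hc1, rfl⟩ ?_
  rintro E ⟨φ, hφK, hφ1, rfl⟩
  have h1 := minEnergyOn_le_rayleigh_of_mem (isHermitian_Hcan L U' g) K hφK hφ1
  have h2 := re_rayleigh_Hcan_le_add_U L hU g hφ1
  linarith

/-- **`E₀(Hgc)` is non-decreasing in `U`** … -/
theorem groundEnergy_Hgc_mono_U (L : ℕ) [NeZero L] {U U' : ℝ} (hU : U ≤ U') (μ g : ℝ) :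
    (Hgc L U μ g).groundEnergy ≤ (Hgc L U' μ g).groundEnergy := by
  refine groundEnergy_mono_of_posSemidef_sub (isHermitian_Hgc L U μ g) (isHermitian_Hgc L U' μ g) ?_
  rw [Hgc_sub_Hgc_U]
  exact (posSemidef_sum_numberOp_mul_numberOp (Λ := FermionTorus 2 L)).smul
    (Complex.zero_le_real.2 (sub_nonneg.2 hU))

/-- … and moves by at most `(U' − U)L²`. -/
theorem groundEnergy_Hgc_le_add_U (L : ℕ) [NeZero L] {U U' : ℝ} (hU : U ≤ U') (μ g : ℝ) :
    (Hgc L U' μ g).groundEnergy ≤ (Hgc L U μ g).groundEnergy + (U' - U) * (L : ℝ) ^ 2 := by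
  obtain ⟨ψ, hψ1, hray⟩ := Matrix.exists_groundState_unit (isHermitian_Hgc L U μ g)
  have htrial := groundEnergy_le_rayleigh_holds (isHermitian_Hgc L U' μ g) ψ hψ1
  have hsplit : (star ψ ⬝ᵥ Hgc L U' μ g *ᵥ ψ).re = (Hgc L U μ g).groundEnergy +
      (U' - U) * (star ψ ⬝ᵥ (∑ x : FermionTorus 2 L, numberOp x 0 * numberOp x 1) *ᵥ ψ).re := by
    rw [(sub_eq_iff_eq_add'.1 (Hgc_sub_Hgc_U L U U' μ g)), add_mulVec, dotProduct_add, Complex.add_re, hray,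
      smul_mulVec, dotProduct_smul, smul_eq_mul, Complex.re_ofReal_mul]
  rw [hsplit] at htrial
  have h := (re_rayleigh_interaction_mem_Icc L hψ1).2
  nlinarith [sub_nonneg.2 hU]

/-- **Template F (coupling transfer of the T = 0 hull gap).** For `U ≤ U'`, every `μ, ν, g`, `K ≠ ⊥`:
`Gap(U') ≤ Gap(U) + (U' − U)L²` and `Gap(U) ≤ Gap(U') + (U' − U)L²`, `Gap(U) := minE(Hcan(U,g),K) − ν − E₀(Hgc(U,μ,g))`. -/
theorem hullGap_coupling_transfer (L : ℕ) [NeZero L] {U U' : ℝ} (hU : U ≤ U') (μ ν g : ℝ)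
    (K : Submodule ℂ (Fock (Orb (FermionTorus 2 L)))) (hK : K ≠ ⊥) :
    (Hcan L U' g).minEnergyOn K - ν - (Hgc L U' μ g).groundEnergy ≤
        ((Hcan L U g).minEnergyOn K - ν - (Hgc L U μ g).groundEnergy) + (U' - U) * (L : ℝ) ^ 2 ∧
      (Hcan L U g).minEnergyOn K - ν - (Hgc L U μ g).groundEnergy ≤
        ((Hcan L U' g).minEnergyOn K - ν - (Hgc L U' μ g).groundEnergy) + (U' - U) * (L : ℝ) ^ 2 := by
  have h1 := minEnergyOn_Hcan_le_add_U L hU g K hK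
  have h2 := groundEnergy_Hgc_mono_U L hU μ g
  have h3 := minEnergyOn_Hcan_mono_U L hU g K hK
  have h4 := groundEnergy_Hgc_le_add_U L hU μ g
  constructor <;> linarith

/-! ### Template H — the defect floor (the entropy allowance is load-bearing)

The defect functional `D_L(β,μ;U,g) = e_L + p_L(β,μ) − μ n_L` of the crux is bounded BELOW, uniformly in
`L ≥ 3`: `D_L ≥ (2/β) log(1 + e^{−8β}) − U − 32 g` (free thermal entropy `2Σ_k log(1 + e^{−β|ξ_k|})` above the
free ground energy, from the tree's exact BdG partition function at zero source and `(1 + cosh y)/2 =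
e^y(1 + e^{−y})²/4`; the seed is dropped by Loewner monotonicity of `log Z` and `E₀`, the repulsion costs `≤ U`
per site by the Lipschitz bound `|log Z(H₁) − log Z(H₂)| ≤ β‖H₁ − H₂‖` and `E₀`-monotonicity). Consequences:
the crux with allowance `a(β)` in place of `log 4/β` is FALSE as soon as `a(β₀) < (2/β₀) log(1 + e^{−8β₀})`
at one `β₀ ≥ 1` (`cruxWithAllowance_false_of_lt`; witness `U, g → 0⁺`, `β = β₀`); in particular the crux
WITHOUT allowance is false (`cruxNoAllowance_false`) — any proof must spend the allowance — and no allowance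
decaying faster than `e^{−8β}` can hold. The crux's own `log 4/β` is above the floor for every `β`
(`defect_floor_lt_allowance`): calibration, not a kill. Kit j011869 tabulates the free thermal excess
`X(β, n) = min_μ D(β, μ; 0, 0)` against `log 4/β`. Def-free copy: `Negative/DefectFloor.lean`. -/

/-- `(1 + cosh y)/2 = e^y (1 + e^{−y})²/4`. [folklore] -/
theorem one_add_cosh_div_two_eq (y : ℝ) :
    (1 + Real.cosh y) / 2 = Real.exp y * (1 + Real.exp (-y)) ^ 2 / 4 := by
  have h : Real.exp y * Real.exp (-y) = 1 := by rw [← Real.exp_add, add_neg_cancel, Real.exp_zero]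
  rw [Real.cosh_eq]
  linear_combination (-(2 + Real.exp (-y)) / 4) * h

/-- `log((1 + cosh y)/2) = y + 2 log(1 + e^{−y}) − log 4`. [folklore] -/
theorem log_one_add_cosh_div_two_eq (y : ℝ) :
    Real.log ((1 + Real.cosh y) / 2) = y + 2 * Real.log (1 + Real.exp (-y)) - Real.log 4 := by
  rw [one_add_cosh_div_two_eq]
  have h1 : 0 < 1 + Real.exp (-y) := by positivity
  rw [Real.log_div (by positivity) (by norm_num), Real.log_mul (Real.exp_pos _).ne' (by positivity),
    Real.log_exp, Real.log_pow]
  push_cast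
  ring

/-- The free per-mode factor with its entropy kept: for `β ≥ 0` and `|ξ| ≤ Ξ`,
`−βξ + β|ξ| + 2 log(1 + e^{−βΞ}) − log 4 ≤ log(e^{−βξ}(1 + cosh(β|ξ|))/2)`. [folklore] -/
theorem log_freeModeFactor_ge {β ξ Ξ : ℝ} (hβ : 0 ≤ β) (hξ : |ξ| ≤ Ξ) :
    -(β * ξ) + β * |ξ| + 2 * Real.log (1 + Real.exp (-(β * Ξ))) - Real.log 4 ≤
      Real.log (Real.exp (-(β * ξ)) * ((1 + Real.cosh (β * |ξ|)) / 2)) := by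
  have hc : 0 < (1 + Real.cosh (β * |ξ|)) / 2 := by
    have := Real.one_le_cosh (β * |ξ|); positivity
  rw [Real.log_mul (Real.exp_pos _).ne' hc.ne', Real.log_exp, log_one_add_cosh_div_two_eq]
  have hyY : β * |ξ| ≤ β * Ξ := mul_le_mul_of_nonneg_left hξ hβ
  have h : Real.log (1 + Real.exp (-(β * Ξ))) ≤ Real.log (1 + Real.exp (-(β * |ξ|))) :=
    Real.log_le_log (by positivity) (by
      apply add_le_add le_rfl
      exact Real.exp_le_exp.2 (by linarith))
  linarith

/-- **Free thermal entropy floor** (`L ≥ 3`, `β ≥ 0`, `|ε_L(k) − μ| ≤ Ξ` for all `k`):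
`−2β Σ_k min(ε_L(k) − μ, 0) + 2L² log(1 + e^{−βΞ}) ≤ log Re Z_β(hubbardTorusWith 2 L 1 0 μ)`. [folklore] -/
theorem log_partitionFn_free_torus_ge (L : ℕ) [NeZero L] (hL : 3 ≤ L) {β : ℝ} (hβ : 0 ≤ β) (μ Ξ : ℝ)
    (hΞ : ∀ k : TorusSite 2 L, |torusBand L k - μ| ≤ Ξ) :
    -(2 * β * ∑ k : TorusSite 2 L, min (torusBand L k - μ) 0) +
        2 * (L : ℝ) ^ 2 * Real.log (1 + Real.exp (-(β * Ξ))) ≤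
      Real.log (partitionFn β (hubbardTorusWith 2 L 1 0 μ)).re := by
  have hZ := partitionFn_dWaveSourceTorus_zero_re hL β μ 0
  rw [dWaveSourceTorus_zero] at hZ
  have hsimp : ∀ k : TorusSite 2 L, Real.sqrt ((torusBand L k - μ) ^ 2 + (2 * Real.sqrt 2 * 0 * dWaveGap k) ^ 2) =
      |torusBand L k - μ| := fun k => by
    rw [mul_zero, zero_mul, zero_pow two_ne_zero, add_zero, Real.sqrt_sq_eq_abs]
  simp_rw [hsimp] at hZ
  rw [hZ, card_orb_fermionTorus_two]
  have hpow : (0 : ℝ) < (2 : ℝ) ^ (2 * L ^ 2) := by positivity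
  have hfac : ∀ k : TorusSite 2 L, Real.exp (-(β * (torusBand L k - μ))) *
      ((1 + Real.cosh (β * |torusBand L k - μ|)) / 2) ≠ 0 := fun k => by
    have := Real.one_le_cosh (β * |torusBand L k - μ|); positivity
  rw [Real.log_mul hpow.ne' (Finset.prod_ne_zero_iff.2 fun k _ => hfac k),
    Real.log_prod (s := Finset.univ) (hf := fun k _ => hfac k), Real.log_pow]
  have hlo : ∑ k : TorusSite 2 L, (-(β * (torusBand L k - μ)) + β * |torusBand L k - μ| +
      2 * Real.log (1 + Real.exp (-(β * Ξ))) - Real.log 4) ≤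
      ∑ k : TorusSite 2 L, Real.log (Real.exp (-(β * (torusBand L k - μ))) *
        ((1 + Real.cosh (β * |torusBand L k - μ|)) / 2)) :=
    Finset.sum_le_sum fun k _ => log_freeModeFactor_ge hβ (hΞ k)
  have hid : ∀ k : TorusSite 2 L, -(β * (torusBand L k - μ)) + β * |torusBand L k - μ| =
      -2 * β * min (torusBand L k - μ) 0 := fun k => by
    have := neg_add_abs_eq (torusBand L k - μ)
    linear_combination β * this
  simp_rw [hid] at hlo
  rw [Finset.sum_sub_distrib, Finset.sum_add_distrib, Finset.sum_const, Finset.sum_const, Finset.card_univ,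
    card_torusSite_two, nsmul_eq_mul, nsmul_eq_mul, ← Finset.mul_sum] at hlo
  have hlog4 : Real.log 4 = 2 * Real.log 2 := by
    rw [show (4 : ℝ) = 2 ^ 2 by norm_num, Real.log_pow]; push_cast; ring
  have hcast : ((L ^ 2 : ℕ) : ℝ) = (L : ℝ) ^ 2 := by push_cast; ring
  have hcast2 : ((2 * L ^ 2 : ℕ) : ℝ) = 2 * (L : ℝ) ^ 2 := by push_cast; ring
  rw [hcast] at hlo
  rw [hcast2]
  rw [hlog4] at hlo
  linarith

/-- The same through the free ground energy and for `|μ| ≤ 4` (`Ξ = 8`):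
`−β E₀(K⁰_μ) + 2L² log(1 + e^{−8β}) ≤ log Re Z_β(K⁰_μ)`, `K⁰_μ = hubbardTorusWith 2 L 1 0 μ`. [folklore] -/
theorem log_partitionFn_free_torus_ge_groundEnergy (L : ℕ) [NeZero L] (hL : 3 ≤ L) {β : ℝ} (hβ : 0 ≤ β)
    {μ : ℝ} (hμ : |μ| ≤ 4) :
    -(β * (hubbardTorusWith 2 L 1 0 μ).groundEnergy) + 2 * (L : ℝ) ^ 2 * Real.log (1 + Real.exp (-(8 * β))) ≤
      Real.log (partitionFn β (hubbardTorusWith 2 L 1 0 μ)).re := by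
  have hΞ : ∀ k : TorusSite 2 L, |torusBand L k - μ| ≤ 8 := fun k => by
    have h1 := abs_torusBand_le L k
    have h2 : |torusBand L k - μ| ≤ |torusBand L k| + |μ| := abs_sub _ _
    norm_num at h1
    linarith
  have h := log_partitionFn_free_torus_ge L hL hβ μ 8 hΞ
  rw [groundEnergy_hubbardTorusWith_zero hL μ, show β * 8 = 8 * β by ring] at *
  linarith

/-- **Pressure floor for the seeded model** (`L ≥ 3`, `U, g, β ≥ 0`, `|μ| ≤ 4`):
`log Re Z_β(Hgc(U, μ, g)) ≥ −β E₀(K⁰_μ) + 2L² log(1 + e^{−8β}) − βUL²`. [folklore] -/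
theorem log_partitionFn_Hgc_ge (L : ℕ) [NeZero L] (hL : 3 ≤ L) {U g β μ : ℝ} (hU : 0 ≤ U)
    (hg : 0 ≤ g) (hβ : 0 ≤ β) (hμ : |μ| ≤ 4) :
    -(β * (hubbardTorusWith 2 L 1 0 μ).groundEnergy) + 2 * (L : ℝ) ^ 2 * Real.log (1 + Real.exp (-(8 * β))) -
        β * U * (L : ℝ) ^ 2 ≤ Real.log ((Hgc L U μ g).partitionFn β).re := by
  have hLpos : (0 : ℝ) < (L : ℝ) ^ 2 := cast_sq_pos_of_neZero L
  -- (a) drop the seed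
  have hseed : Real.log (partitionFn β (hubbardTorusWith 2 L 1 U μ)).re ≤ Real.log ((Hgc L U μ g).partitionFn β).re := by
    refine log_partitionFn_le_of_posSemidef (isHermitian_Hgc L U μ g) (isHermitian_hubbardTorusWith L 1 U μ) hβ ?_
    simp only [Hgc]
    rw [sub_sub_cancel]
    exact (pairField_conjTranspose_mul_self_posSemidef dWaveFormFactor L).smul
      (Complex.zero_le_real.2 (div_nonneg hg hLpos.le))
  -- (b) pay the repulsion
  have hW : hubbardTorusWith 2 L 1 U μ =
      hubbardTorusWith 2 L 1 0 μ + (U : ℂ) • ∑ x : FermionTorus 2 L, numberOp x 0 * numberOp x 1 := by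
    have h := hamiltonianWith_sub_hamiltonianWith (fermionTorusGraph 2 L) 1 0 U μ
    rw [sub_zero] at h
    change hubbardTorusWith 2 L 1 U μ - hubbardTorusWith 2 L 1 0 μ = _ at h
    rw [← h]; abel
  have hWnorm : ‖(U : ℂ) • ∑ x : FermionTorus 2 L,
      (numberOp x 0 * numberOp x 1 : Matrix (Finset (Orb (FermionTorus 2 L))) (Finset (Orb (FermionTorus 2 L))) ℂ)‖ ≤
      U * (L : ℝ) ^ 2 := by
    rw [norm_smul, Complex.norm_real, Real.norm_of_nonneg hU]
    exact mul_le_mul_of_nonneg_left (norm_interaction_le L) hU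
  have hrep : Real.log (partitionFn β (hubbardTorusWith 2 L 1 0 μ)).re -
      Real.log (partitionFn β (hubbardTorusWith 2 L 1 U μ)).re ≤ β * (U * (L : ℝ) ^ 2) := by
    refine (log_partitionFn_sub_log_partitionFn_le (isHermitian_hubbardTorusWith L 1 0 μ)
      (isHermitian_hubbardTorusWith L 1 U μ) hβ).trans ?_
    rw [hW, add_sub_cancel_left]
    exact mul_le_mul_of_nonneg_left hWnorm hβ
  -- (c) the free floor
  have hfree := log_partitionFn_free_torus_ge_groundEnergy L hL hβ hμ
  nlinarith [hfree, hrep, hseed]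

/-- **Grand-canonical ground energy below every sector** (the T = 0 trivial half): for a sector `K ≠ ⊥` of
`N`-particle vectors, `E₀(Hgc(U,μ,g)) + μN ≤ minE(Hcan(U,g), K)`. [folklore] -/
theorem groundEnergy_Hgc_add_le_minEnergyOn (L : ℕ) [NeZero L] (U μ g : ℝ) {N : ℕ}
    (K : Submodule ℂ (Fock (Orb (FermionTorus 2 L)))) (hK : K ≠ ⊥) (hKN : ∀ ψ ∈ K, IsNParticle N ψ) :
    (Hgc L U μ g).groundEnergy + μ * N ≤ (Hcan L U g).minEnergyOn K := by
  obtain ⟨v, hvK, hv0⟩ := (Submodule.ne_bot_iff K).1 hK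
  obtain ⟨c, -, hc1⟩ := exists_smul_unit hv0
  refine le_csInf ⟨_, c • v, K.smul_mem c hvK, hc1, rfl⟩ ?_
  rintro E ⟨φ, hφK, hφ1, rfl⟩
  have h := groundEnergy_le_rayleigh_holds (isHermitian_Hgc L U μ g) φ hφ1
  rw [re_rayleigh_Hgc L U μ g (hKN φ hφK) hφ1] at h
  linarith

/-- **TEMPLATE H — THE DEFECT FLOOR.** For `L ≥ 3`, `U, g ≥ 0`, `β > 0`, `|μ| ≤ 4` and every sector `K ≠ ⊥` of
`N`-particle vectors:
`(2/β) log(1 + e^{−8β}) − U − 32g ≤ minE(Hcan, K)/L² + log Re Z(β, Hgc μ)/(βL²) − μN/L²`. [folklore] -/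
theorem defect_floor (L : ℕ) [NeZero L] (hL : 3 ≤ L) {U g β μ : ℝ} (hU : 0 ≤ U) (hg : 0 ≤ g)
    (hβ : 0 < β) (hμ : |μ| ≤ 4) {N : ℕ} (K : Submodule ℂ (Fock (Orb (FermionTorus 2 L)))) (hK : K ≠ ⊥)
    (hKN : ∀ ψ ∈ K, IsNParticle N ψ) :
    2 / β * Real.log (1 + Real.exp (-(8 * β))) - U - 32 * g ≤
      (Hcan L U g).minEnergyOn K / (L : ℝ) ^ 2 + Real.log ((Hgc L U μ g).partitionFn β).re / (β * (L : ℝ) ^ 2) -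
        μ * N / (L : ℝ) ^ 2 := by
  have hLpos : (0 : ℝ) < (L : ℝ) ^ 2 := cast_sq_pos_of_neZero L
  have hβL : 0 < β * (L : ℝ) ^ 2 := mul_pos hβ hLpos
  have h1 := groundEnergy_Hgc_add_le_minEnergyOn L U μ g K hK hKN
  have h2 := groundEnergy_Hgc_mono_U L hU μ g
  have h3 := groundEnergy_Hgc_le_add L 0 μ (g₀ := 0) hg
  have h30 : Hgc L 0 μ 0 = hubbardTorusWith 2 L 1 0 μ := by
    simp only [Hgc]; rw [zero_div, Complex.ofReal_zero, zero_smul, sub_zero]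
  rw [h30, sub_zero] at h3
  have h4 := log_partitionFn_Hgc_ge L hL hU hg hβ.le hμ
  set A := (Hcan L U g).minEnergyOn K
  set Z := Real.log ((Hgc L U μ g).partitionFn β).re
  set E := (hubbardTorusWith 2 L 1 0 μ).groundEnergy
  set ℓ := Real.log (1 + Real.exp (-(8 * β)))
  have hA : E - 32 * g * (L : ℝ) ^ 2 ≤ A - μ * N := by linarith
  have hZ' : -(E / (L : ℝ) ^ 2) + 2 / β * ℓ - U ≤ Z / (β * (L : ℝ) ^ 2) := by
    rw [le_div_iff₀ hβL]
    have : (-(E / (L : ℝ) ^ 2) + 2 / β * ℓ - U) * (β * (L : ℝ) ^ 2) =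
        -(β * E) + 2 * (L : ℝ) ^ 2 * ℓ - β * U * (L : ℝ) ^ 2 := by
      field_simp
    linarith
  have hA' : (E - 32 * g * (L : ℝ) ^ 2) / (L : ℝ) ^ 2 ≤ (A - μ * N) / (L : ℝ) ^ 2 :=
    div_le_div_of_nonneg_right hA hLpos.le
  have e1 : (E - 32 * g * (L : ℝ) ^ 2) / (L : ℝ) ^ 2 = E / (L : ℝ) ^ 2 - 32 * g := by
    rw [sub_div, mul_div_assoc, div_self hLpos.ne', mul_one]
  have e2 : (A - μ * N) / (L : ℝ) ^ 2 = A / (L : ℝ) ^ 2 - μ * N / (L : ℝ) ^ 2 := by rw [sub_div]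
  rw [e1, e2] at hA'
  linarith

/-- The crux's sector is a legitimate instance: `szSector N_L 0 ≠ ⊥` for `δ ≥ 0` (`⌊(1−δ)L²/2⌋₊ ≤ L²`). [folklore] -/
theorem szSector_NL_ne_bot (L : ℕ) [NeZero L] {δ : ℝ} (hδ : 0 ≤ δ) :
    szSector (Λ := FermionTorus 2 L) (NL δ L) 0 ≠ ⊥ := by
  have hn : ⌊(1 - δ) * (L : ℝ) ^ 2 / 2⌋₊ ≤ Fintype.card (FermionTorus 2 L) := by
    rw [card_fermionTorus]
    have hL : (0 : ℝ) ≤ (L : ℝ) ^ 2 := sq_nonneg _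
    have h1 : (1 - δ) * (L : ℝ) ^ 2 / 2 ≤ (L : ℝ) ^ 2 := by nlinarith
    have h2 : ((⌊(1 - δ) * (L : ℝ) ^ 2 / 2⌋₊ : ℕ) : ℝ) ≤ (L : ℝ) ^ 2 := by
      rcases le_or_gt 0 ((1 - δ) * (L : ℝ) ^ 2 / 2) with h | h
      · exact (Nat.floor_le h).trans h1
      · rw [Nat.floor_of_nonpos h.le]; simp
    exact_mod_cast h2
  obtain ⟨⟨ψ, hψS, hψ0, -⟩, -⟩ := szSector_groundState (fermionTorusGraph 2 L) 1 0 hn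
  rw [Submodule.ne_bot_iff]
  exact ⟨ψ, hψS, hψ0⟩

/-- **The defect floor at the crux's own sector**, in the crux's literal normalisation (`L ≥ 3`, `U, g ≥ 0`,
`β > 0`, `|μ| ≤ 4`, `δ ≥ 0`). -/
theorem defect_floor_crux (L : ℕ) [NeZero L] (hL : 3 ≤ L) {U g β μ δ : ℝ} (hU : 0 ≤ U) (hg : 0 ≤ g)
    (hβ : 0 < β) (hμ : |μ| ≤ 4) (hδ : 0 ≤ δ) :
    2 / β * Real.log (1 + Real.exp (-(8 * β))) - U - 32 * g ≤
      (Hcan L U g).minEnergyOn (szSector (Λ := FermionTorus 2 L) (NL δ L) 0) / (L : ℝ) ^ 2 +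
        Real.log ((Hgc L U μ g).partitionFn β).re / (β * (L : ℝ) ^ 2) -
        μ * (2 * (⌊(1 - δ) * (L : ℝ) ^ 2 / 2⌋₊ : ℝ)) / (L : ℝ) ^ 2 := by
  have h := defect_floor L hL hU hg hβ hμ (N := NL δ L) (szSector (Λ := FermionTorus 2 L) (NL δ L) 0)
    (szSector_NL_ne_bot L hδ) (fun ψ hψ => ((mem_szSector_iff _ _ ψ).1 hψ).1)
  rwa [cast_NL] at h

/-- The crux with a general entropy allowance `a(β)` in place of `log 4/β`. -/
def CruxWithAllowance (a : ℝ → ℝ) : Prop :=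
  ∀ δ ∈ Set.Icc (1/10 : ℝ) (2/5 : ℝ), ∃ μ₁ μ₂ : ℝ, -4 < μ₁ ∧ μ₁ ≤ μ₂ ∧ μ₂ < 0 ∧ ∃ U₀ : ℝ, 0 < U₀ ∧
    ∀ U ∈ Set.Ioc (0 : ℝ) U₀, ∀ g ∈ Set.Ioc (0 : ℝ) (1 / 10), ∀ β : ℝ, 1 ≤ β →
      ∃ μ ∈ Set.Icc μ₁ μ₂, ∀ ε : ℝ, 0 < ε → ∃ L₀ : ℕ, ∀ (L : ℕ) [NeZero L], L₀ ≤ L →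
        (Hcan L U g).minEnergyOn (szSector (Λ := FermionTorus 2 L) (NL δ L) 0) / (L : ℝ) ^ 2 +
            Real.log ((Hgc L U μ g).partitionFn β).re / (β * (L : ℝ) ^ 2) -
            μ * (2 * (⌊(1 - δ) * (L : ℝ) ^ 2 / 2⌋₊ : ℝ)) / (L : ℝ) ^ 2 ≤ a β + ε

/-- The crux is the instance `a(β) = log 4/β` (definitional). -/
theorem crux_iff_cruxWithAllowance_log4 :
    TwSeededEnsembleEquivalence ↔ CruxWithAllowance fun β => Real.log 4 / β := Iff.rfl

/-- The crux WITHOUT entropy allowance (`a ≡ 0`). -/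
def CruxNoAllowance : Prop := CruxWithAllowance fun _ => 0

/-- Allowances are monotone: `a ≤ b` pointwise on `[1, ∞)` and `CruxWithAllowance a` give `CruxWithAllowance b`. -/
theorem CruxWithAllowance.mono {a b : ℝ → ℝ} (hab : ∀ β, 1 ≤ β → a β ≤ b β) (h : CruxWithAllowance a) :
    CruxWithAllowance b := by
  intro δ hδ
  obtain ⟨μ₁, μ₂, hμ₁, hμ₁₂, hμ₂, U₀, hU₀, hU⟩ := h δ hδ
  refine ⟨μ₁, μ₂, hμ₁, hμ₁₂, hμ₂, U₀, hU₀, fun U hUm g hg β hβ => ?_⟩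
  obtain ⟨μ, hμm, hμ⟩ := hU U hUm g hg β hβ
  refine ⟨μ, hμm, fun ε hε => ?_⟩
  obtain ⟨L₀, hL₀⟩ := hμ ε hε
  exact ⟨L₀, fun L _ hL => (hL₀ L hL).trans (by linarith [hab β hβ])⟩

/-- **Template H, kill form: any allowance below the floor is refuted.** If `a(β₀) < (2/β₀) log(1 + e^{−8β₀})`
at some `β₀ ≥ 1` then `¬ CruxWithAllowance a` (witness: `δ = 1/10`, `β = β₀`, `U = min U₀ (c/4)`,
`g = min (1/10) (c/128)`, `ε = c/4`, `c` the gap below the floor, `L = max L₀ 3`). -/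
theorem cruxWithAllowance_false_of_lt (a : ℝ → ℝ) {β₀ : ℝ} (hβ₀ : 1 ≤ β₀)
    (ha : a β₀ < 2 / β₀ * Real.log (1 + Real.exp (-(8 * β₀)))) : ¬ CruxWithAllowance a := by
  intro H
  set c := 2 / β₀ * Real.log (1 + Real.exp (-(8 * β₀))) - a β₀ with hc
  have hcpos : 0 < c := by rw [hc]; linarith
  have hδ : (1/10 : ℝ) ∈ Set.Icc (1/10 : ℝ) (2/5 : ℝ) := ⟨le_rfl, by norm_num⟩
  obtain ⟨μ₁, μ₂, hμ₁, hμ₁₂, hμ₂, U₀, hU₀, hU⟩ := H (1/10) hδ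
  have hUm : min U₀ (c / 4) ∈ Set.Ioc (0 : ℝ) U₀ := ⟨lt_min hU₀ (by positivity), min_le_left _ _⟩
  have hgm : min (1/10 : ℝ) (c / 128) ∈ Set.Ioc (0 : ℝ) (1 / 10) := ⟨lt_min (by norm_num) (by positivity), min_le_left _ _⟩
  obtain ⟨μ, hμm, hμ⟩ := hU _ hUm _ hgm β₀ hβ₀
  obtain ⟨L₀, hL₀⟩ := hμ (c / 4) (by positivity)
  haveI : NeZero (max L₀ 3) := ⟨by omega⟩
  have hinst := hL₀ (max L₀ 3) (le_max_left _ _)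
  have hμabs : |μ| ≤ 4 := by
    rw [abs_le]; constructor <;> linarith [hμm.1, hμm.2]
  have hfloor := defect_floor_crux (max L₀ 3) (le_max_right _ _) (U := min U₀ (c / 4))
    (g := min (1/10 : ℝ) (c / 128)) (δ := 1/10) hUm.1.le hgm.1.le (lt_of_lt_of_le one_pos hβ₀) hμabs (by norm_num)
  have hU4 : min U₀ (c / 4) ≤ c / 4 := min_le_right _ _
  have hg128 : min (1/10 : ℝ) (c / 128) ≤ c / 128 := min_le_right _ _
  linarith

/-- **The entropy allowance is load-bearing**: the crux without allowance is FALSE (`a ≡ 0`, `β₀ = 1`). -/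
theorem cruxNoAllowance_false : ¬ CruxNoAllowance := by
  refine cruxWithAllowance_false_of_lt (fun _ => 0) le_rfl ?_
  have : 0 < Real.log (1 + Real.exp (-(8 * (1 : ℝ)))) := Real.log_pos (by linarith [Real.exp_pos (-(8 * (1:ℝ)))])
  positivity

/-- **No allowance decaying faster than `e^{−8β}` can hold**: e.g. `a(β) = e^{−9β}` is refuted (at `β₀ = 3`:
`e^{−27} < (2/3) log(1 + e^{−24})`, since `log(1 + x) ≥ x/2` for `0 ≤ x ≤ 1` and `e^{−27} < e^{−24}/3`). -/
theorem cruxWithAllowance_exp_false : ¬ CruxWithAllowance fun β => Real.exp (-(9 * β)) := by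
  refine cruxWithAllowance_false_of_lt _ (β₀ := 3) (by norm_num) ?_
  have hx0 : 0 < Real.exp (-(8 * (3 : ℝ))) := Real.exp_pos _
  have hx1 : Real.exp (-(8 * (3 : ℝ))) ≤ 1 := by
    rw [show (1 : ℝ) = Real.exp 0 by rw [Real.exp_zero]]; exact Real.exp_le_exp.2 (by norm_num)
  -- log(1 + x) ≥ x/2 on [0,1]: from log(1+x) ≥ x/(1+x) ≥ x/2
  have hlog : Real.exp (-(8 * (3 : ℝ))) / 2 ≤ Real.log (1 + Real.exp (-(8 * (3 : ℝ)))) := by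
    have h := Real.add_one_le_exp (Real.log (1 + Real.exp (-(8 * (3 : ℝ)))))
    have h1 : (1 : ℝ) + Real.exp (-(8 * 3)) ≠ 0 := by positivity
    rw [Real.exp_log (by positivity)] at h
    -- use log(1+x) ≥ 1 - 1/(1+x) = x/(1+x)
    have h2 := Real.one_sub_inv_le_log_of_pos (show 0 < 1 + Real.exp (-(8 * (3 : ℝ))) by positivity)
    have h3 : 1 - (1 + Real.exp (-(8 * (3 : ℝ))))⁻¹ = Real.exp (-(8 * 3)) / (1 + Real.exp (-(8 * 3))) := by
      field_simp; ring
    rw [h3] at h2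
    have h4 : Real.exp (-(8 * (3 : ℝ))) / 2 ≤ Real.exp (-(8 * 3)) / (1 + Real.exp (-(8 * 3))) := by
      apply div_le_div_of_nonneg_left hx0.le (by positivity)
      linarith
    exact h4.trans h2
  -- e^{−27} < e^{−24}/3
  have hexp : Real.exp (-(9 * (3 : ℝ))) < Real.exp (-(8 * 3)) / 3 := by
    have h := Real.exp_add (-(9 * (3 : ℝ)) + (8 * 3)) (-(8 * 3))
    rw [show -(9 * (3 : ℝ)) + 8 * 3 + -(8 * 3) = -(9 * 3) by ring] at h
    rw [h, show -(8 * (3:ℝ)) = -(8 * 3) by rfl]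
    have h3 : Real.exp (-(9 * (3 : ℝ)) + 8 * 3) < 1 / 3 := by
      rw [show -(9 * (3 : ℝ)) + 8 * 3 = -3 by norm_num]
      have := Real.exp_neg (3 : ℝ)
      rw [this]
      rw [inv_eq_one_div, div_lt_div_iff_of_pos_left one_pos (Real.exp_pos 3) (by norm_num)]
      have := Real.add_one_le_exp (3 : ℝ)
      linarith
    calc Real.exp (-(9 * (3 : ℝ)) + 8 * 3) * Real.exp (-(8 * 3))
        < 1 / 3 * Real.exp (-(8 * 3)) := mul_lt_mul_of_pos_right h3 (Real.exp_pos _)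
      _ = Real.exp (-(8 * 3)) / 3 := by ring
  have : 2 / (3 : ℝ) * Real.log (1 + Real.exp (-(8 * 3))) ≥ Real.exp (-(8 * 3)) / 3 := by nlinarith
  linarith

/-- **Calibration: the floor sits below the crux's allowance**, `(2/β) log(1 + e^{−8β}) < log 4/β` for every
`β > 0` — Template H refutes no instance of the crux itself. -/
theorem defect_floor_lt_allowance {β : ℝ} (hβ : 0 < β) :
    2 / β * Real.log (1 + Real.exp (-(8 * β))) < Real.log 4 / β := by
  have h1 : Real.exp (-(8 * β)) < 1 := by
    have := Real.exp_lt_exp.2 (show -(8 * β) < 0 by linarith)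
    rwa [Real.exp_zero] at this
  have h2 : Real.log (1 + Real.exp (-(8 * β))) < Real.log 2 :=
    Real.log_lt_log (by positivity) (by linarith)
  have hlog4 : Real.log 4 = 2 * Real.log 2 := by
    rw [show (4 : ℝ) = 2 ^ 2 by norm_num, Real.log_pow]; push_cast; ring
  rw [hlog4, div_mul_eq_mul_div, div_lt_div_iff_of_pos_right hβ]
  linarith

end Gen4

/-! ## Gen 4 (cont.) — Template I: half filling is excluded for a reason (the doping window is load-bearing)

The crux quantifies `δ ∈ [1/10, 2/5]`. Its BODY at `δ = 0` (half filling) is FALSE (`cruxBodyAt_zero_false`):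
for every window `[μ₁,μ₂] ⊂ (−4,0)` and `U₀ > 0` the disprover takes `U, g → 0⁺`, `β` large and EVEN `L → ∞`
and finds a macroscopic T = 0 hull gap at half filling against every slope `μ ≤ μ₂ < 0`
(`hullGap_halfFilling_ge`: `minE(Hcan, szSector L² 0) − μL² − E₀(Hgc μ) ≥ (|μ|³/(2048π²) − U − 32g)L²`).
Physically: at half filling the chemical potential is `U/2 > 0` (particle–hole symmetry), outside every negative
window. This is also the END-TO-END ROAD TEST of the kill pipeline (Template C kill form ← Templates E/F transfers
← a free-fermion hull gap); a real kill of the crux would differ only in the physics input replacing the free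
count below. Def-free copies: `Negative/HalfFillingCounting.lean` (p80457) + `Negative/HalfFilling.lean`. -/

section TemplateI

open Literature.Probability.LatticeModels
/-! ### Band facts (antiperiodicity `ε_L(k + (L/2,L/2)) = −ε_L(k)`, even `L`, is the tree's
`Summit.HubbardSuperconductivity.TwTipContinuation.IsogapTransport.torusBand_add_half`, imported) -/

section BandI

variable {L : ℕ} [NeZero L]

/-! ### A box of momenta just above the Fermi level at half filling -/

/-- On the box `q ≤ k_i ≤ q + J` with `L ≤ 4q ≤ L + 3` and `8(J+1) ≤ L`, every angle `2πk_i/L` lies in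
`[π/2, π/2 + 2π(J+1)/L] ⊂ [π/2, π]`, so `−2π(J+1)/L ≤ cos ≤ 0` and `0 ≤ ε_L(k) ≤ 8π(J+1)/L`. [folklore] -/
theorem torusBand_mem_of_box (q J : ℕ) (hq : L ≤ 4 * q) (hq' : 4 * q ≤ L + 3) (hJ : 8 * (J + 1) ≤ L)
    (k : TorusSite 2 L) (hk : ∀ i : Fin 2, q ≤ (k i).val ∧ (k i).val ≤ q + J) :
    0 ≤ torusBand L k ∧ torusBand L k ≤ 8 * Real.pi * (J + 1) / L := by
  have hL0 : 0 < L := Nat.pos_of_ne_zero (NeZero.ne L)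
  have hLr : (0 : ℝ) < L := by exact_mod_cast hL0
  set T : ℝ := 2 * Real.pi * (J + 1) / L with hT
  have hTpos : 0 ≤ T := by positivity
  have hTle : T ≤ Real.pi / 2 := by
    rw [hT, div_le_iff₀ hLr]
    have : (8 : ℝ) * (J + 1) ≤ L := by exact_mod_cast hJ
    nlinarith [Real.pi_pos]
  -- each angle is in [π/2, π/2 + T]
  have hang : ∀ x : ℕ, q ≤ x → x ≤ q + J →
      Real.pi / 2 ≤ 2 * Real.pi * (x : ℝ) / L ∧ 2 * Real.pi * (x : ℝ) / L ≤ Real.pi / 2 + T := by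
    intro x hx1 hx2
    have hx1r : (q : ℝ) ≤ x := by exact_mod_cast hx1
    have hx2r : (x : ℝ) ≤ q + J := by exact_mod_cast hx2
    have hqr : (L : ℝ) ≤ 4 * q := by exact_mod_cast hq
    have hqr' : 4 * (q : ℝ) ≤ L + 3 := by exact_mod_cast hq'
    constructor
    · rw [le_div_iff₀ hLr]
      have h4 : 4 * (q : ℝ) ≤ 4 * x := by linarith
      nlinarith [mul_le_mul_of_nonneg_left (hqr.trans h4) (by positivity : (0 : ℝ) ≤ Real.pi / 2), Real.pi_pos]
    · have h : 2 * Real.pi * (x : ℝ) / L ≤ Real.pi / 2 + 2 * Real.pi * (J + 1) / L := by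
        have e : Real.pi / 2 + 2 * Real.pi * (J + 1) / L = (Real.pi / 2 * L + 2 * Real.pi * (J + 1)) / L := by
          field_simp
        rw [e, div_le_div_iff_of_pos_right hLr]
        nlinarith [mul_le_mul_of_nonneg_left hx2r (by positivity : (0 : ℝ) ≤ 2 * Real.pi),
          mul_le_mul_of_nonneg_left hqr' (by positivity : (0 : ℝ) ≤ Real.pi / 2), Real.pi_pos]
      rw [hT]; exact h
  have hcos : ∀ x : ℕ, q ≤ x → x ≤ q + J →
      -T ≤ Real.cos (2 * Real.pi * (x : ℝ) / L) ∧ Real.cos (2 * Real.pi * (x : ℝ) / L) ≤ 0 := by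
    intro x hx1 hx2
    obtain ⟨ha1, ha2⟩ := hang x hx1 hx2
    constructor
    · have h1 : Real.cos (Real.pi / 2 + T) ≤ Real.cos (2 * Real.pi * (x : ℝ) / L) :=
        Real.cos_le_cos_of_nonneg_of_le_pi (by linarith [Real.pi_pos]) (by linarith) ha2
      have h2 : Real.cos (Real.pi / 2 + T) = -Real.sin T := by
        rw [Real.cos_add, Real.cos_pi_div_two, Real.sin_pi_div_two]; ring
      have h3 : Real.sin T ≤ T := Real.sin_le hTpos
      linarith
    · have h1 : Real.cos (2 * Real.pi * (x : ℝ) / L) ≤ Real.cos (Real.pi / 2) :=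
        Real.cos_le_cos_of_nonneg_of_le_pi (by linarith [Real.pi_pos]) (by linarith) ha1
      rwa [Real.cos_pi_div_two] at h1
  have hc0 := hcos (k 0).val (hk 0).1 (hk 0).2
  have hc1 := hcos (k 1).val (hk 1).1 (hk 1).2
  have hband : torusBand L k =
      -2 * (Real.cos (2 * Real.pi * ((k 0).val : ℝ) / L) + Real.cos (2 * Real.pi * ((k 1).val : ℝ) / L)) := by
    simp only [torusBand, Fin.sum_univ_two, latticeMomentum_apply]
  rw [hband]
  constructor
  · nlinarith [hc0.2, hc1.2]
  · have : -2 * (Real.cos (2 * Real.pi * ((k 0).val : ℝ) / L) + Real.cos (2 * Real.pi * ((k 1).val : ℝ) / L)) ≤ 4 * T := by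
      nlinarith [hc0.1, hc1.1]
    rw [hT] at this
    calc _ ≤ 4 * (2 * Real.pi * (J + 1) / L) := this
      _ = 8 * Real.pi * (J + 1) / L := by ring

/-- **Box count**: with `L ≤ 4q ≤ L + 3` and `8(J+1) ≤ L`, at least `(J+1)²` momenta have
`0 ≤ ε_L(k) ≤ 8π(J+1)/L` (the box `(q + j₀, q + j₁)`, `j₀, j₁ ≤ J`). [folklore] -/
theorem sq_le_card_filter_torusBand_small (q J : ℕ) (hq : L ≤ 4 * q) (hq' : 4 * q ≤ L + 3)
    (hJ : 8 * (J + 1) ≤ L) :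
    (J + 1) ^ 2 ≤ (Finset.univ.filter fun k : TorusSite 2 L =>
      0 ≤ torusBand L k ∧ torusBand L k ≤ 8 * Real.pi * (J + 1) / L).card := by
  classical
  set F : ℕ × ℕ → TorusSite 2 L := fun p i => if i = 0 then ((q + p.1 : ℕ) : ZMod L) else ((q + p.2 : ℕ) : ZMod L)
    with hF
  have hF0 : ∀ p : ℕ × ℕ, q + p.1 < L → (F p 0).val = q + p.1 := fun p hp => by
    show ((q + p.1 : ℕ) : ZMod L).val = q + p.1
    rw [ZMod.val_natCast, Nat.mod_eq_of_lt hp]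
  have hF1 : ∀ p : ℕ × ℕ, q + p.2 < L → (F p 1).val = q + p.2 := fun p hp => by
    show (if (1 : Fin 2) = 0 then ((q + p.1 : ℕ) : ZMod L) else ((q + p.2 : ℕ) : ZMod L)).val = q + p.2
    rw [if_neg (by decide), ZMod.val_natCast, Nat.mod_eq_of_lt hp]
  set S := (Finset.range (J + 1)) ×ˢ (Finset.range (J + 1)) with hS
  have hinj : Set.InjOn F S := by
    intro p hp p' hp' heq
    simp only [hS, Finset.coe_product, Finset.coe_range, Set.mem_prod, Set.mem_Iio] at hp hp'
    have e0 := congrArg ZMod.val (congrFun heq 0)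
    have e1 := congrArg ZMod.val (congrFun heq 1)
    rw [hF0 p (by omega), hF0 p' (by omega)] at e0
    rw [hF1 p (by omega), hF1 p' (by omega)] at e1
    exact Prod.ext (by omega) (by omega)
  have hcard : (S.image F).card = (J + 1) ^ 2 := by
    rw [Finset.card_image_of_injOn hinj, hS, Finset.card_product, Finset.card_range, sq]
  rw [← hcard]
  refine Finset.card_le_card fun k hk => ?_
  rw [Finset.mem_image] at hk
  obtain ⟨p, hp, rfl⟩ := hk
  simp only [hS, Finset.mem_product, Finset.mem_range] at hp
  rw [Finset.mem_filter]
  refine ⟨Finset.mem_univ _, torusBand_mem_of_box q J hq hq' hJ (F p) fun i => ?_⟩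
  fin_cases i
  · show q ≤ (F p 0).val ∧ (F p 0).val ≤ q + J
    rw [hF0 p (by omega)]; omega
  · show q ≤ (F p 1).val ∧ (F p 1).val ≤ q + J
    rw [hF1 p (by omega)]; omega

/-- **Extensive count near the Fermi level**: for `0 < a ≤ 2` and `16π/a ≤ L`... precisely whenever
`1 ≤ aL/(16π)`: `#{k : |ε_L(k)| ≤ a} ≥ (aL/(16π))²`. [folklore] -/
theorem sq_le_card_filter_abs_torusBand_le {a : ℝ} (ha : 0 < a) (ha2 : a ≤ 2) (hL : 1 ≤ a * L / (16 * Real.pi)) :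
    (a * L / (16 * Real.pi)) ^ 2 ≤
      ((Finset.univ.filter fun k : TorusSite 2 L => |torusBand L k| ≤ a).card : ℝ) := by
  have hL0 : 0 < L := Nat.pos_of_ne_zero (NeZero.ne L)
  have hLr : (0 : ℝ) < L := by exact_mod_cast hL0
  have hπ := Real.pi_pos
  have hπ3 := Real.pi_gt_three
  set n : ℕ := ⌊a * L / (8 * Real.pi)⌋₊ with hn
  have hx0 : 0 ≤ a * L / (8 * Real.pi) := by positivity
  have hnle : (n : ℝ) ≤ a * L / (8 * Real.pi) := Nat.floor_le hx0
  have hnge : a * L / (8 * Real.pi) - 1 ≤ n := by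
    have := Nat.lt_floor_add_one (a * L / (8 * Real.pi)); rw [← hn] at this; linarith
  have h2 : a * L / (8 * Real.pi) = 2 * (a * L / (16 * Real.pi)) := by
    rw [mul_div_assoc' 2, div_eq_div_iff (by positivity) (by positivity)]; ring
  have hn1 : (1 : ℝ) ≤ n := by linarith
  have hn1' : 1 ≤ n := by exact_mod_cast hn1
  -- 8 n ≤ L (since a ≤ 2 < 8π... a L/(8π) ≤ L/(4π) < L/8)
  have h8n : 8 * n ≤ L := by
    have : 8 * (n : ℝ) ≤ L := by
      have : 8 * (a * L / (8 * Real.pi)) = a * L / Real.pi := by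
        rw [mul_div_assoc' 8, div_eq_div_iff (by positivity) (by positivity)]; ring
      have h3 : a * L / Real.pi ≤ L := by
        rw [div_le_iff₀ hπ]; nlinarith
      linarith
    exact_mod_cast this
  set q : ℕ := (L + 3) / 4 with hq
  have hq1 : L ≤ 4 * q := by omega
  have hq2 : 4 * q ≤ L + 3 := by omega
  have hJ : 8 * (n - 1 + 1) ≤ L := by rw [Nat.sub_add_cancel hn1']; exact h8n
  have hbox := sq_le_card_filter_torusBand_small q (n - 1) hq1 hq2 hJ
  rw [Nat.sub_add_cancel hn1'] at hbox
  -- the box levels satisfy |ε| ≤ 8π n/L ≤ a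
  have hthr : 8 * Real.pi * ((n - 1 : ℕ) + 1 : ℝ) / L ≤ a := by
    have : ((n - 1 : ℕ) : ℝ) + 1 = n := by
      rw [Nat.cast_sub hn1']; push_cast; ring
    rw [this, div_le_iff₀ hLr]
    have := mul_le_mul_of_nonneg_left hnle (by positivity : (0 : ℝ) ≤ 8 * Real.pi)
    have h4 : 8 * Real.pi * (a * L / (8 * Real.pi)) = a * L := by field_simp
    linarith
  have hsub : (Finset.univ.filter fun k : TorusSite 2 L =>
      0 ≤ torusBand L k ∧ torusBand L k ≤ 8 * Real.pi * ((n - 1 : ℕ) + 1) / L) ⊆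
      (Finset.univ.filter fun k : TorusSite 2 L => |torusBand L k| ≤ a) := by
    intro k hk
    rw [Finset.mem_filter] at hk ⊢
    refine ⟨hk.1, ?_⟩
    rw [abs_le]
    exact ⟨by linarith [hk.2.1], hk.2.2.trans hthr⟩
  have hcardle := Finset.card_le_card hsub
  have : ((n : ℝ)) ^ 2 ≤ ((Finset.univ.filter fun k : TorusSite 2 L => |torusBand L k| ≤ a).card : ℝ) := by
    have := hbox.trans hcardle
    exact_mod_cast this
  have hn2 : a * L / (16 * Real.pi) ≤ n := by linarith
  calc (a * L / (16 * Real.pi)) ^ 2 ≤ (n : ℝ) ^ 2 := pow_le_pow_left₀ (by positivity) hn2 2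
    _ ≤ _ := this

/-! ### The pointwise Legendre bookkeeping at half filling -/

/-- `f(ε) + f(−ε) ≥ m·𝟙[|ε| ≤ m/2]` for `f(ε) = 2min(ε,0) − 2min(ε+m,0) + m`, `m ≥ 0`. [folklore] -/
theorem legendre_pair_ge {m ε : ℝ} (hm : 0 ≤ m) :
    m * (if |ε| ≤ m / 2 then 1 else 0) ≤
      (2 * min ε 0 - 2 * min (ε + m) 0 + m) + (2 * min (-ε) 0 - 2 * min (-ε + m) 0 + m) := by
  split_ifs with h
  · rw [abs_le] at h
    rw [min_eq_right (by linarith : (0:ℝ) ≤ ε + m), min_eq_right (by linarith : (0:ℝ) ≤ -ε + m)]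
    rcases le_or_gt ε 0 with hε | hε
    · rw [min_eq_left hε, min_eq_right (by linarith : (0:ℝ) ≤ -ε)]; linarith
    · rw [min_eq_right hε.le, min_eq_left (by linarith : -ε ≤ 0)]; linarith
  · rw [mul_zero]
    rcases le_or_gt ε 0 with hε | hε
    · rw [min_eq_left hε, min_eq_right (by linarith : (0:ℝ) ≤ -ε), min_eq_right (by linarith : (0:ℝ) ≤ -ε + m)]
      rcases le_or_gt (ε + m) 0 with h1 | h1
      · rw [min_eq_left h1]; linarith
      · rw [min_eq_right h1.le]; linarith
    · rw [min_eq_right hε.le, min_eq_left (by linarith : -ε ≤ 0), min_eq_right (by linarith : (0:ℝ) ≤ ε + m)]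
      rcases le_or_gt (-ε + m) 0 with h1 | h1
      · rw [min_eq_left h1]; linarith
      · rw [min_eq_right h1.le]; linarith

/-- **The free Legendre defect at half filling is extensive**: for even `L`, `μ = −m < 0`,
`2Σ_k min(ε_k,0) − 2Σ_k min(ε_k + m, 0) + m L² ≥ (m/2)·#{k : |ε_k| ≤ m/2}`. [folklore] -/
theorem free_legendre_defect_halfFilling_ge (hL : Even L) {m : ℝ} (hm : 0 ≤ m) :
    m / 2 * ((Finset.univ.filter fun k : TorusSite 2 L => |torusBand L k| ≤ m / 2).card : ℝ) ≤
      2 * ∑ k : TorusSite 2 L, min (torusBand L k) 0 - 2 * ∑ k : TorusSite 2 L, min (torusBand L k + m) 0 +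
        m * (L : ℝ) ^ 2 := by
  set Q : TorusSite 2 L := fun _ => ((L / 2 : ℕ) : ZMod L) with hQ
  set f : ℝ → ℝ := fun ε => 2 * min ε 0 - 2 * min (ε + m) 0 + m with hf
  have hsumf : ∑ k : TorusSite 2 L, f (torusBand L k) =
      2 * ∑ k : TorusSite 2 L, min (torusBand L k) 0 - 2 * ∑ k : TorusSite 2 L, min (torusBand L k + m) 0 +
        m * (L : ℝ) ^ 2 := by
    simp only [hf, Finset.sum_add_distrib, Finset.sum_sub_distrib, ← Finset.mul_sum, Finset.sum_const,
      Finset.card_univ, card_torusSite_two, nsmul_eq_mul]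
    push_cast; ring
  have hperm : ∑ k : TorusSite 2 L, f (torusBand L (k + Q)) = ∑ k : TorusSite 2 L, f (torusBand L k) :=
    Fintype.sum_equiv (Equiv.addRight Q) _ _ (fun k => rfl)
  have hpair : ∀ k : TorusSite 2 L, m * (if |torusBand L k| ≤ m / 2 then 1 else 0) ≤
      f (torusBand L k) + f (torusBand L (k + Q)) := by
    intro k
    rw [Summit.HubbardSuperconductivity.TwTipContinuation.IsogapTransport.torusBand_add_half hL]
    exact legendre_pair_ge hm
  have hsum2 : m * ((Finset.univ.filter fun k : TorusSite 2 L => |torusBand L k| ≤ m / 2).card : ℝ) ≤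
      2 * ∑ k : TorusSite 2 L, f (torusBand L k) := by
    have h1 : ∑ k : TorusSite 2 L, m * (if |torusBand L k| ≤ m / 2 then (1 : ℝ) else 0) ≤
        ∑ k : TorusSite 2 L, (f (torusBand L k) + f (torusBand L (k + Q))) :=
      Finset.sum_le_sum fun k _ => hpair k
    rw [← Finset.mul_sum, Finset.sum_boole, Finset.sum_add_distrib, hperm] at h1
    push_cast at h1
    linarith
  rw [← hsumf]
  linarith

end BandI

/-- Pure lower bound for seeded sector energies: `minE(H₀(U), K) ≤ minE(Hcan(U,g), K) + 32gL²` (`K ≠ ⊥`, `g ≥ 0`). -/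
theorem minEnergyOn_pure_le_Hcan_add (L : ℕ) [NeZero L] (U : ℝ) {g : ℝ} (hg : 0 ≤ g)
    (K : Submodule ℂ (Fock (Orb (FermionTorus 2 L)))) (hK : K ≠ ⊥) :
    (hubbardTorus 2 L 1 U).minEnergyOn K ≤ (Hcan L U g).minEnergyOn K + 32 * g * (L : ℝ) ^ 2 := by
  obtain ⟨v, hvK, hv0⟩ := (Submodule.ne_bot_iff K).1 hK
  obtain ⟨c, -, hc1⟩ := exists_smul_unit hv0
  rw [← sub_le_iff_le_add]
  refine le_csInf ⟨_, c • v, K.smul_mem c hvK, hc1, rfl⟩ ?_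
  rintro E ⟨φ, hφK, hφ1, rfl⟩
  have hH : (hubbardTorus 2 L 1 U).IsHermitian := by
    rw [← hubbardTorusWith_zero]; exact isHermitian_hubbardTorusWith L 1 U 0
  have h1 := minEnergyOn_le_rayleigh_of_mem hH K hφK hφ1
  have h2 := re_rayleigh_pure_le_Hcan_add L (U := U) hg hφ1
  linarith

/-- `E₀(Hgc(U,μ,g)) ≤ E₀(K⁰_μ) + UL²` for `U, g ≥ 0` (seed lowers, coupling raises by ≤ `UL²`). -/
theorem groundEnergy_Hgc_le_free_add (L : ℕ) [NeZero L] {U g : ℝ} (hU : 0 ≤ U) (hg : 0 ≤ g) (μ : ℝ) :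
    (Hgc L U μ g).groundEnergy ≤ (hubbardTorusWith 2 L 1 0 μ).groundEnergy + U * (L : ℝ) ^ 2 := by
  have h1 := groundEnergy_Hgc_anti L U μ (g₀ := 0) hg
  have h2 := groundEnergy_Hgc_le_add_U L hU μ 0
  have h0 : Hgc L 0 μ 0 = hubbardTorusWith 2 L 1 0 μ := by
    simp only [Hgc]; rw [zero_div, Complex.ofReal_zero, zero_smul, sub_zero]
  rw [h0, sub_zero] at h2
  linarith

/-- **TEMPLATE I — THE HULL GAP AT HALF FILLING.** For even `L ≥ 3`, `U, g ≥ 0`, a slope `−4 ≤ μ < 0` with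
`1 ≤ (|μ|/2)L/(16π)` and every sector `K ≠ ⊥` of `L²`-particle vectors:
`minE(Hcan(U,g), K) − μL² − E₀(Hgc(U,μ,g)) ≥ (|μ|³/(2048π²) − U − 32g)·L²`. -/
theorem hullGap_halfFilling_ge (L : ℕ) [NeZero L] (hL3 : 3 ≤ L) (hLe : Even L) {U g μ : ℝ} (hU : 0 ≤ U)
    (hg : 0 ≤ g) (hμ : μ < 0) (hμ4 : -4 ≤ μ) (hLm : 1 ≤ -μ / 2 * L / (16 * Real.pi))
    (K : Submodule ℂ (Fock (Orb (FermionTorus 2 L)))) (hK : K ≠ ⊥) (hKN : ∀ ψ ∈ K, IsNParticle (L ^ 2) ψ) :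
    ((-μ) ^ 3 / (2048 * Real.pi ^ 2) - U - 32 * g) * (L : ℝ) ^ 2 ≤
      (Hcan L U g).minEnergyOn K - μ * (L : ℝ) ^ 2 - (Hgc L U μ g).groundEnergy := by
  have hLpos : (0 : ℝ) < (L : ℝ) ^ 2 := cast_sq_pos_of_neZero L
  have h1 := minEnergyOn_Hcan_mono_U L hU g K hK
  have h2 := minEnergyOn_pure_le_Hcan_add L 0 hg K hK
  have h3 := groundEnergy_Hgc_add_le_minEnergyOn L 0 0 0 K hK hKN
  have h3' : (hubbardTorusWith 2 L 1 0 0).groundEnergy ≤ (hubbardTorus 2 L 1 0).minEnergyOn K := by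
    have e1 : Hgc L 0 0 0 = hubbardTorusWith 2 L 1 0 0 := by
      simp only [Hgc]; rw [zero_div, Complex.ofReal_zero, zero_smul, sub_zero]
    have e2 : Hcan L 0 0 = hubbardTorus 2 L 1 0 := by
      simp only [Hcan]; rw [zero_div, Complex.ofReal_zero, zero_smul, sub_zero]
    rw [e1, e2, zero_mul, add_zero] at h3
    exact h3
  have h4 := groundEnergy_Hgc_le_free_add L hU hg μ
  rw [groundEnergy_hubbardTorusWith_zero hL3 0] at h3'
  rw [groundEnergy_hubbardTorusWith_zero hL3 μ] at h4
  set m : ℝ := -μ with hm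
  have hm0 : 0 ≤ m := by rw [hm]; linarith
  have hsub : ∀ k : TorusSite 2 L, torusBand L k - μ = torusBand L k + m := fun k => by rw [hm]; ring
  simp only [sub_zero] at h3'
  simp only [hsub] at h4
  have h5 := free_legendre_defect_halfFilling_ge hLe hm0
  have h6 := sq_le_card_filter_abs_torusBand_le (L := L) (a := m / 2) (by rw [hm]; linarith) (by rw [hm]; linarith) hLm
  have hcnt : m ^ 3 / (2048 * Real.pi ^ 2) * (L : ℝ) ^ 2 ≤
      m / 2 * ((Finset.univ.filter fun k : TorusSite 2 L => |torusBand L k| ≤ m / 2).card : ℝ) := by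
    have : m / 2 * (m / 2 * L / (16 * Real.pi)) ^ 2 = m ^ 3 / (2048 * Real.pi ^ 2) * (L : ℝ) ^ 2 := by
      field_simp; ring
    rw [← this]
    exact mul_le_mul_of_nonneg_left h6 (by positivity)
  linarith [h1, h2, h3', h4, h5, hcnt, hLpos, hm]

/-- The crux's sector at `δ = 0` and even `L`: `N_L = 2⌊(1 − 0)L²/2⌋₊ = L²`. -/
theorem NL_zero_of_even {L : ℕ} (hL : Even L) : NL 0 L = L ^ 2 := by
  obtain ⟨M, hM⟩ := hL
  have h : (1 - (0 : ℝ)) * (L : ℝ) ^ 2 / 2 = ((2 * M ^ 2 : ℕ) : ℝ) := by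
    rw [hM]; push_cast; ring
  simp only [NL]
  rw [h, Nat.floor_natCast, hM]; ring

/-- The crux's BODY at doping `δ` (the crux is `∀ δ ∈ [1/10, 2/5], CruxBodyAt δ`, definitionally). -/
def CruxBodyAt (δ : ℝ) : Prop :=
  ∃ μ₁ μ₂ : ℝ, -4 < μ₁ ∧ μ₁ ≤ μ₂ ∧ μ₂ < 0 ∧ ∃ U₀ : ℝ, 0 < U₀ ∧
    ∀ U ∈ Set.Ioc (0 : ℝ) U₀, ∀ g ∈ Set.Ioc (0 : ℝ) (1 / 10), ∀ β : ℝ, 1 ≤ β →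
      ∃ μ ∈ Set.Icc μ₁ μ₂, ∀ ε : ℝ, 0 < ε → ∃ L₀ : ℕ, ∀ (L : ℕ) [NeZero L], L₀ ≤ L →
        (Hcan L U g).minEnergyOn (szSector (Λ := FermionTorus 2 L) (NL δ L) 0) / (L : ℝ) ^ 2 +
            Real.log ((Hgc L U μ g).partitionFn β).re / (β * (L : ℝ) ^ 2) -
            μ * (2 * (⌊(1 - δ) * (L : ℝ) ^ 2 / 2⌋₊ : ℝ)) / (L : ℝ) ^ 2 ≤ Real.log 4 / β + ε

theorem crux_iff_forall_cruxBodyAt :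
    TwSeededEnsembleEquivalence ↔ ∀ δ ∈ Set.Icc (1/10 : ℝ) (2/5 : ℝ), CruxBodyAt δ := Iff.rfl

/-- **Template I, kill form: the doping window is load-bearing** — `¬ CruxBodyAt 0`. For every window and `U₀`,
the disprover's `U = min U₀ (κ/4)`, `g = min (1/10) (κ/128)`, `β = max 1 (8 log 4/κ)`, even `L → ∞`
(`κ = |μ₂|³/(2048π²)`) violate the inequality at half filling. -/
theorem cruxBodyAt_zero_false : ¬ CruxBodyAt 0 := by
  rintro ⟨μ₁, μ₂, hμ₁, hμ₁₂, hμ₂, U₀, hU₀, H⟩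
  have hπ := Real.pi_pos
  set m : ℝ := -μ₂ with hmdef
  have hm : 0 < m := by rw [hmdef]; linarith
  set κ : ℝ := m ^ 3 / (2048 * Real.pi ^ 2) with hκ
  have hκpos : 0 < κ := by positivity
  have hUm : min U₀ (κ / 4) ∈ Set.Ioc (0 : ℝ) U₀ := ⟨lt_min hU₀ (by positivity), min_le_left _ _⟩
  have hgm : min (1/10 : ℝ) (κ / 128) ∈ Set.Ioc (0 : ℝ) (1 / 10) := ⟨lt_min (by norm_num) (by positivity), min_le_left _ _⟩
  set β : ℝ := max 1 (8 * Real.log 4 / κ) with hβdef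
  have hβ1 : 1 ≤ β := le_max_left _ _
  have hβpos : 0 < β := lt_of_lt_of_le one_pos hβ1
  have hlog4 : 0 < Real.log 4 := Real.log_pos (by norm_num)
  have hslack : Real.log 4 / β ≤ κ / 8 := by
    rw [div_le_iff₀ hβpos]
    have : 8 * Real.log 4 / κ ≤ β := le_max_right _ _
    rw [div_le_iff₀ hκpos] at this
    linarith
  obtain ⟨μ, hμm, hμ⟩ := H _ hUm _ hgm β hβ1
  obtain ⟨L₀, hL₀⟩ := hμ (κ / 8) (by positivity)
  obtain ⟨L₁, hL₁⟩ := exists_nat_gt (64 * Real.pi / m)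
  set L : ℕ := 2 * (max (max L₀ L₁) 2) with hLdef
  have hLe : Even L := ⟨max (max L₀ L₁) 2, by rw [hLdef]; ring⟩
  have hL0le : L₀ ≤ L := by
    have : L₀ ≤ max (max L₀ L₁) 2 := (le_max_left _ _).trans (le_max_left _ _)
    omega
  have hL4 : 4 ≤ L := by have : 2 ≤ max (max L₀ L₁) 2 := le_max_right _ _; omega
  have hL1le : (L₁ : ℝ) ≤ L := by
    have : L₁ ≤ L := by
      have : L₁ ≤ max (max L₀ L₁) 2 := (le_max_right _ _).trans (le_max_left _ _)
      omega
    exact_mod_cast this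
  haveI : NeZero L := ⟨by omega⟩
  have hLr : (0 : ℝ) < L := by exact_mod_cast (show 0 < L by omega)
  have hLpos : (0 : ℝ) < (L : ℝ) ^ 2 := cast_sq_pos_of_neZero L
  have hinst := hL₀ L hL0le
  have hμneg : μ < 0 := lt_of_le_of_lt hμm.2 hμ₂
  have hμ4 : -4 ≤ μ := by linarith [hμm.1]
  have hmle : m ≤ -μ := by rw [hmdef]; linarith [hμm.2]
  have hLm : 1 ≤ -μ / 2 * L / (16 * Real.pi) := by
    rw [le_div_iff₀ (by positivity)]
    have h1 : 64 * Real.pi / m < L := hL₁.trans_le hL1le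
    rw [div_lt_iff₀ hm] at h1
    nlinarith [mul_nonneg (sub_nonneg.2 hmle) hLr.le]
  have hNL : NL 0 L = L ^ 2 := NL_zero_of_even hLe
  have hNLr : (2 : ℝ) * (⌊(1 - (0 : ℝ)) * (L : ℝ) ^ 2 / 2⌋₊ : ℝ) = (L : ℝ) ^ 2 := by
    have := cast_NL 0 L; rw [hNL] at this; push_cast at this; linarith
  have hKne : szSector (Λ := FermionTorus 2 L) (L ^ 2) 0 ≠ ⊥ := by
    obtain ⟨M, hM⟩ := hLe
    have hsq : L ^ 2 = 2 * (2 * M ^ 2) := by rw [hM]; ring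
    have hn : 2 * M ^ 2 ≤ Fintype.card (FermionTorus 2 L) := by rw [card_fermionTorus, hsq]; omega
    obtain ⟨⟨ψ, hψS, hψ0, -⟩, -⟩ := szSector_groundState (fermionTorusGraph 2 L) 1 0 hn
    rw [hsq, Submodule.ne_bot_iff]
    exact ⟨ψ, hψS, hψ0⟩
  have hKN : ∀ ψ ∈ szSector (Λ := FermionTorus 2 L) (L ^ 2) 0, IsNParticle (L ^ 2) ψ :=
    fun ψ hψ => ((mem_szSector_iff _ _ ψ).1 hψ).1
  have hgap := hullGap_halfFilling_ge L (by omega) hLe (U := min U₀ (κ / 4)) (g := min (1/10 : ℝ) (κ / 128))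
    hUm.1.le hgm.1.le hμneg hμ4 hLm (szSector (Λ := FermionTorus 2 L) (L ^ 2) 0) hKne hKN
  rw [hNL, hNLr] at hinst
  set A := (Hcan L (min U₀ (κ / 4)) (min (1/10 : ℝ) (κ / 128))).minEnergyOn
      (szSector (Λ := FermionTorus 2 L) (L ^ 2) 0) with hA
  have hZ : -(β * (Hgc L (min U₀ (κ / 4)) μ (min (1/10 : ℝ) (κ / 128))).groundEnergy) ≤
      Real.log ((Hgc L (min U₀ (κ / 4)) μ (min (1/10 : ℝ) (κ / 128))).partitionFn β).re :=
    neg_mul_groundEnergy_le_log_partitionFn (isHermitian_Hgc L _ μ _) β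
  set E := (Hgc L (min U₀ (κ / 4)) μ (min (1/10 : ℝ) (κ / 128))).groundEnergy with hE
  set Z := Real.log ((Hgc L (min U₀ (κ / 4)) μ (min (1/10 : ℝ) (κ / 128))).partitionFn β).re with hZdef
  have hZ' : -(E / (L : ℝ) ^ 2) ≤ Z / (β * (L : ℝ) ^ 2) := by
    rw [le_div_iff₀ (mul_pos hβpos hLpos)]
    have : -(E / (L : ℝ) ^ 2) * (β * (L : ℝ) ^ 2) = -(β * E) := by
      field_simp
    linarith
  have hκ' : κ ≤ (-μ) ^ 3 / (2048 * Real.pi ^ 2) := by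
    rw [hκ]; apply div_le_div_of_nonneg_right _ (by positivity)
    exact pow_le_pow_left₀ hm.le hmle 3
  have hU4 : min U₀ (κ / 4) ≤ κ / 4 := min_le_right _ _
  have hg128 : min (1/10 : ℝ) (κ / 128) ≤ κ / 128 := min_le_right _ _
  have hgap' : κ / 2 ≤ A / (L : ℝ) ^ 2 - μ - E / (L : ℝ) ^ 2 := by
    have h1 : (κ / 2) * (L : ℝ) ^ 2 ≤ A - μ * (L : ℝ) ^ 2 - E := by
      refine le_trans ?_ hgap
      apply mul_le_mul_of_nonneg_right _ hLpos.le
      linarith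
    have h2 := div_le_div_of_nonneg_right h1 hLpos.le
    rw [mul_div_assoc, div_self hLpos.ne', mul_one] at h2
    have e : (A - μ * (L : ℝ) ^ 2 - E) / (L : ℝ) ^ 2 = A / (L : ℝ) ^ 2 - μ - E / (L : ℝ) ^ 2 := by
      field_simp
    rw [e] at h2
    exact h2
  have hinst' : A / (L : ℝ) ^ 2 + Z / (β * (L : ℝ) ^ 2) - μ * (L : ℝ) ^ 2 / (L : ℝ) ^ 2 ≤
      Real.log 4 / β + κ / 8 := hinst
  rw [mul_div_assoc, div_self hLpos.ne', mul_one] at hinst'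
  linarith

/-- The full crux is untouched by Template I: `δ = 0 ∉ [1/10, 2/5]`. Recorded for the audit trail. -/
theorem zero_not_mem_window : (0 : ℝ) ∉ Set.Icc (1/10 : ℝ) (2/5 : ℝ) := by
  intro h; linarith [h.1]

end TemplateI

end

end Summit.HubbardSuperconductivity.HubbardSuperconductivity.Cruxes.TwSeededEnsembleEquivalence.Disproof
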